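import Literature.Probability.Percolation.TriClaim10Prep
import Literature.Probability.Percolation.TriIfaceOrbit3
import HarnessLib

/-!
# Claim 10 of Bollobás–Riordan in the frame of `A₀`: the interface does not close up

Topic `Literature/Probability/Percolation`; family `crit-perc`. Second half of the proof of the
weak form of **Claim 10** (Bollobás–Riordan, *Percolation* (2006), Ch. 7, pp. 178–179:
"Suppose next that the component of `I` containing `f` is a cycle … Our aim is to deduce a
contradiction"): the walk of the interface machine (`TriIface3.lean`, `TriIfaceOrbit3.lean`)
from the face `w`, if it came back to `w`, would provide — from its right (black) cells
`h₁ = x₂, …, h_t = x₁` ("each `hᵢ` is black, `hᵢ` is adjacent to `hᵢ₊₁`") between the last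
anchor `r` on `P₂ ∪ A₂⁺` and the first anchor `s ≥ r` on `P₁ ∪ A₁⁺` — an admissible open path
`P' ⊆ P₁ ∪ P₂ ∪ S` separating `w` from `A₀`. The Jordan-curve steps of the source ("every `hᵢ`
lies on or outside `C`", "`P'` lies on or outside `C`, so it separates `z`") are replaced by
winding labels: `P'` traverses a necklace bond backwards, whose face of the walk is then right of
`P'` (`cyc_false_of_reversed_dart`); contacts with the black boundary are read through the
positions of the boundary darts (`cyc_outer_pos`, `cyc_block_exit_two`, `false_of_two_sided`);
the degenerate contacts are bumps of the path against the boundary (`false_of_bump`,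
`false_of_contact_one/two`). Main result: `TriMarkedDomain.cyc_false`. Theorems only.

## References

* B. Bollobás, O. Riordan, *Percolation*, Cambridge University Press (2006), Ch. 7, Claim 10
  pp. 178–179, Fig. 15.

## Mathlib / tree

Tree: `TriIface3.lean`, `TriIfaceOrbit3.lean`, `TriClaim10Prep.lean`, `TriChordSides(2).lean`,
`TriFaceLabel.lean`; `tail_not_interleaved` (`TriDiscSeparation.lean`). Mathlib:
`SimpleGraph.Walk.bypass`, `Nat.findGreatest`, `Nat.find`.
-/

noncomputable section

namespace Literature.Probability.Percolation

open LatticeModels Finset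
open RemovableAt (hexFaceVertices_leftFaceDir)

/-! ## The cycle case: the walk of the interface read step by step -/

namespace TriMarkedDomain

section CycleFacts

variable (D : TriMarkedDomain 3) {ω : Set (Site 2)} {orb : ℕ → HexVertex} {N : ℕ}
  (horb : ∀ k < N, D.ifaceNext₃ ω (orb k) = some (orb (k + 1)))
  (hleft : ∀ k < N, D.leftCell₃ ω (orb k) ∈ D.verts)

include horb in
/-- Along the walk every face has an exit side. [folklore] -/
theorem cyc_exists_isExit {k : ℕ} (hk : k < N) : ∃ j, D.IsExit₃ ω (orb k) j := by
  obtain ⟨j, hj, -⟩ := D.ifaceNext_eq_some₃ (horb k hk)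
  exact ⟨j, hj⟩

include horb in
/-- The next face is across the exit side. [folklore] -/
theorem cyc_succ_eq {k : ℕ} (hk : k < N) : orb (k + 1) = oppFace (orb k) (D.exitSide₃ ω (orb k)) := by
  obtain ⟨j, hj⟩ := D.cyc_exists_isExit horb hk
  have := D.ifaceNext_eq_some_oppFace₃ hj
  rw [horb k hk] at this
  exact Option.some_injective _ this

include horb in
/-- **The next face is the face left of the dart from the left cell to the right cell.** [folklore] -/
theorem cyc_succ_eq_leftFace {k : ℕ} (hk : k < N) :
    orb (k + 1) = leftFace (D.leftCell₃ ω (orb k)) (D.rightCell₃ ω (orb k)) := by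
  rw [D.cyc_succ_eq horb hk, ← D.faceVertex_next_succ₃ (B := ω) (orb k), ← D.faceVertex_next_succ_succ₃ (B := ω) (orb k),
    show oppIdx (orb k) (D.exitSide₃ ω (orb k)) + 2 = oppIdx (orb k) (D.exitSide₃ ω (orb k)) + 1 + 1 by
      rw [add_assoc]; rfl, leftFace_faceVertex]

include horb in
/-- The third vertex of the next face is the apex of that dart. [folklore] -/
theorem cyc_faceVertex_oppIdx {k : ℕ} (hk : k < N) :
    faceVertex (orb (k + 1)) (oppIdx (orb k) (D.exitSide₃ ω (orb k))) =
      triLeftApex (D.leftCell₃ ω (orb k)) (D.rightCell₃ ω (orb k)) := by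
  rw [D.cyc_succ_eq horb hk, ← D.faceVertex_next_succ₃ (B := ω) (orb k),
    ← D.faceVertex_next_succ_succ₃ (B := ω) (orb k),
    show oppIdx (orb k) (D.exitSide₃ ω (orb k)) + 2 = oppIdx (orb k) (D.exitSide₃ ω (orb k)) + 1 + 1 by
      rw [add_assoc]; rfl, triLeftApex_faceVertex,
    show oppIdx (orb k) (D.exitSide₃ ω (orb k)) + 1 + 2 = oppIdx (orb k) (D.exitSide₃ ω (orb k)) by
      rw [add_assoc]; exact add_eq_left.2 (by decide)]

include horb hleft in
/-- **One step, for the cells, with the colour of the third vertex**: either the right cell is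
kept and the left cell becomes the apex (white, so a closed site of `G` here), or the left cell
is kept and the right cell becomes the apex (black). [folklore] -/
theorem cyc_cells_succ {k : ℕ} (hk : k + 1 < N) :
    (D.rightCell₃ ω (orb (k + 1)) = D.rightCell₃ ω (orb k) ∧
        D.leftCell₃ ω (orb (k + 1)) = triLeftApex (D.leftCell₃ ω (orb k)) (D.rightCell₃ ω (orb k)) ∧
        triLeftApex (D.leftCell₃ ω (orb k)) (D.rightCell₃ ω (orb k)) ∈ D.verts ∧
        triLeftApex (D.leftCell₃ ω (orb k)) (D.rightCell₃ ω (orb k)) ∉ ω) ∨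
      (D.leftCell₃ ω (orb (k + 1)) = D.leftCell₃ ω (orb k) ∧
        D.rightCell₃ ω (orb (k + 1)) = triLeftApex (D.leftCell₃ ω (orb k)) (D.rightCell₃ ω (orb k)) ∧
        (triLeftApex (D.leftCell₃ ω (orb k)) (D.rightCell₃ ω (orb k)) ∈ D.verts →
          triLeftApex (D.leftCell₃ ω (orb k)) (D.rightCell₃ ω (orb k)) ∈ ω)) := by
  obtain ⟨j, hj⟩ := D.cyc_exists_isExit horb (show k < N by omega)
  obtain ⟨j', hj'⟩ := D.cyc_exists_isExit horb hk
  have hE := D.isEntry_next₃ hj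
  have hF' := D.cyc_succ_eq horb (show k < N by omega)
  have hm := D.cyc_faceVertex_oppIdx horb (show k < N by omega)
  have hp := D.faceVertex_next_succ₃ (B := ω) (orb k)
  have hq := D.faceVertex_next_succ_succ₃ (B := ω) (orb k)
  rw [← hF'] at hE hp hq
  rw [hF'] at hj'
  rw [← hF'] at hj'
  have hG1 := hleft (k + 1) hk
  rcases D.exitSide_cases_of_isEntry₃ hE hj' with ⟨-, hcol, hl, hr⟩ | ⟨-, hcol, hl, hr⟩
  · left
    rw [hm] at hl
    rw [hl] at hG1
    refine ⟨hr.trans hq, hl, hG1, ?_⟩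
    rw [← hm] at hG1 ⊢
    rwa [D.vcol_eq_false_iff_of_mem₃ hG1] at hcol
  · right
    rw [hm] at hr
    refine ⟨hl.trans hp, hr, fun hG => ?_⟩
    rw [← hm] at hG ⊢
    rwa [D.vcol_eq_true_iff_of_mem₃ hG] at hcol

include horb hleft in
/-- **An outer right cell is seen across a black boundary dart from the left cell.** [folklore] -/
theorem cyc_dart_mem_of_not_mem {k : ℕ} (hk : k < N) (hout : D.rightCell₃ ω (orb k) ∉ D.verts) :
    (D.leftCell₃ ω (orb k), D.rightCell₃ ω (orb k)) ∈ triBdryDarts D.verts ∧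
      D.stretchIdx₃ (D.dpos (D.leftCell₃ ω (orb k), D.rightCell₃ ω (orb k))) ≠ 0 := by
  obtain ⟨j, hj⟩ := D.cyc_exists_isExit horb hk
  have hG := hleft k hk
  refine ⟨mem_triBdryDarts.2 ⟨hG, hout, (D.adj_rightCell_leftCell₃ (orb k)).symm⟩, ?_⟩
  have hcol := D.vcol_rightCell₃ hj
  unfold vcol₃ at hcol
  unfold rightCell₃ at hout
  unfold leftCell₃ at hG
  rw [if_neg hout, show D.exitSide₃ ω (orb k) + 1 + 1 = D.exitSide₃ ω (orb k) + 2 by rw [add_assoc]; rfl,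
    if_pos hG] at hcol
  unfold bdryCol₃ bcolOf₃ at hcol
  unfold leftCell₃ rightCell₃
  simpa using hcol

include horb hleft in
/-- **Consecutive outer right cells are seen across consecutive boundary darts**; when the right
cell comes back into `G`, the dart from it to the old outer cell is the next boundary dart. [folklore] -/
theorem cyc_succ_dart {k : ℕ} (hk : k + 1 < N) (hout : D.rightCell₃ ω (orb k) ∉ D.verts) :
    (D.rightCell₃ ω (orb (k + 1)) ∉ D.verts →
        (D.leftCell₃ ω (orb (k + 1)), D.rightCell₃ ω (orb (k + 1))) =
          triBdrySucc D.verts (D.leftCell₃ ω (orb k), D.rightCell₃ ω (orb k))) ∧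
      (D.rightCell₃ ω (orb (k + 1)) ∈ D.verts →
        (D.rightCell₃ ω (orb (k + 1)), D.rightCell₃ ω (orb k)) =
          triBdrySucc D.verts (D.leftCell₃ ω (orb k), D.rightCell₃ ω (orb k))) := by
  rcases D.cyc_cells_succ horb hleft hk with ⟨hr, hl, hG, -⟩ | ⟨hl, hr, -⟩
  · refine ⟨fun _ => ?_, fun hin => absurd (hr ▸ hin) hout⟩
    rw [hl, hr]
    unfold triBdrySucc
    rw [if_pos hG]
  · constructor
    · intro hout'
      rw [hl, hr]
      rw [hr] at hout'
      unfold triBdrySucc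
      rw [if_neg hout']
    · intro hin
      rw [hr]
      rw [hr] at hin
      unfold triBdrySucc
      rw [if_pos hin]

include horb hleft in
/-- **The dart from a right cell of `G` to a new outer right cell is a black boundary dart whose
successor is the dart from the left cell** (the left cell is kept, being the apex). [folklore] -/
theorem cyc_entry_dart {k : ℕ} (hk : k + 1 < N) (hin : D.rightCell₃ ω (orb k) ∈ D.verts)
    (hout : D.rightCell₃ ω (orb (k + 1)) ∉ D.verts) :
    (D.rightCell₃ ω (orb k), D.rightCell₃ ω (orb (k + 1))) ∈ triBdryDarts D.verts ∧
      triBdrySucc D.verts (D.rightCell₃ ω (orb k), D.rightCell₃ ω (orb (k + 1))) =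
        (D.leftCell₃ ω (orb (k + 1)), D.rightCell₃ ω (orb (k + 1))) ∧
      D.leftCell₃ ω (orb (k + 1)) = D.leftCell₃ ω (orb k) ∧
      D.stretchIdx₃ (D.dpos (D.rightCell₃ ω (orb k), D.rightCell₃ ω (orb (k + 1)))) ≠ 0 := by
  rcases D.cyc_cells_succ horb hleft hk with ⟨hr, -, -, -⟩ | ⟨hl, hr, -⟩
  · exact absurd (hr ▸ hin) hout
  · have hF' := D.cyc_succ_eq horb (show k < N by omega)
    have hm := D.cyc_faceVertex_oppIdx horb (show k < N by omega)
    have hp := D.faceVertex_next_succ₃ (B := ω) (orb k)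
    have hq := D.faceVertex_next_succ_succ₃ (B := ω) (orb k)
    rw [← hF'] at hp hq
    set e := oppIdx (orb k) (D.exitSide₃ ω (orb k)) with he
    have hG := hleft k (by omega)
    -- the apex of the dart `ρ → m` in the face `(m, ℓ, ρ)` is `ℓ`
    have e30 : e + 2 + 1 = e := by rw [add_assoc]; exact add_eq_left.2 (by decide)
    have e31 : e + 2 + 2 = e + 1 := by rw [add_assoc]; congr 1
    have hapex : triLeftApex (D.rightCell₃ ω (orb k)) (D.rightCell₃ ω (orb (k + 1))) = D.leftCell₃ ω (orb k) := by
      rw [hr, ← hm, ← hq, ← hp]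
      have := triLeftApex_faceVertex (orb (k + 1)) (e + 2)
      rwa [e30, e31] at this
    have hadj : triGraph.Adj (D.rightCell₃ ω (orb k)) (D.rightCell₃ ω (orb (k + 1))) := by
      rw [hr, ← hm, ← hq]
      have := TriMarkedDomain.adj_faceVertex_succ (orb (k + 1)) (e + 2)
      rwa [e30] at this
    refine ⟨mem_triBdryDarts.2 ⟨hin, hout, hadj⟩, ?_, hl, ?_⟩
    · unfold triBdrySucc
      rw [hapex, if_pos hG, hl]
    · -- the two views of the outer vertex `m` from `ρ` and from `ℓ` agree; from `ℓ` it is black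
      obtain ⟨j', hj'⟩ := D.cyc_exists_isExit horb hk
      have hm_out : faceVertex (orb (k + 1)) e ∉ D.verts := by rw [hm, ← hr]; exact hout
      have hviews := D.bdryCol_views_eq₃ (F := orb (k + 1)) (j := e) hm_out (by rw [hp]; exact hG) (by rw [hq]; exact hin)
      rw [hp, hq, hm, ← hr] at hviews
      -- colour from `ℓ`: the new right cell is black
      have hblack := (D.cyc_dart_mem_of_not_mem horb hleft hk hout).2
      rw [hl] at hblack
      unfold bdryCol₃ bcolOf₃ at hviews
      intro h0
      rw [h0] at hviews
      simp at hviews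
      exact hblack (by simpa using hviews)

/-- **Black boundary darts do not pass from `A₂` to `A₁`**: the successor of a boundary dart of
the stretch `A₂` is in `A₂`, unless it is white (the stretch `A₀` follows `A₂`). [folklore] -/
theorem stretchIdx_succ_eq_two {d : Site 2 × Site 2} (hd : d ∈ triBdryDarts D.verts)
    (h2 : D.stretchIdx₃ (D.dpos d) = 2) (hne : D.stretchIdx₃ (D.dpos (triBdrySucc D.verts d)) ≠ 0) :
    D.stretchIdx₃ (D.dpos (triBdrySucc D.verts d)) = 2 := by
  have hL := D.isTriDisc.card_pos
  have h12 := D.pos_lt_pos₃ (show (1 : Fin 3) < 2 by decide)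
  have hlt := D.dpos_lt hd
  rw [D.dpos_succ hd] at hne ⊢
  unfold stretchIdx₃ at h2 hne ⊢
  rw [Nat.mod_eq_of_lt hlt] at h2
  have hge : D.pos 2 ≤ D.dpos d := by
    by_contra hlt'
    push Not at hlt'
    by_cases h1 : D.dpos d < D.pos 1
    · rw [if_pos h1] at h2; exact absurd h2 (by decide)
    · rw [if_neg h1, if_pos hlt'] at h2; exact absurd h2 (by decide)
  rw [Nat.mod_mod] at hne ⊢
  by_cases hwrap : D.dpos d + 1 < #(triBdryDarts D.verts)
  · rw [Nat.mod_eq_of_lt hwrap, if_neg (by omega), if_neg (by omega)]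
  · have : (D.dpos d + 1) % #(triBdryDarts D.verts) = 0 := by
      rw [show D.dpos d + 1 = #(triBdryDarts D.verts) by omega, Nat.mod_self]
    rw [this] at hne
    have h01 : 0 < D.pos 1 := by
      have hz : D.pos 0 = 0 := D.pos_zero (by decide)
      have := D.pos_lt_pos₃ (show (0 : Fin 3) < 1 by decide)
      omega
    rw [if_pos h01] at hne
    exact absurd rfl hne

include horb hleft in
/-- **Along a block of outer right cells the darts from the left cells stay in `A₂` once there.** [folklore] -/
theorem cyc_block_stretch_two {m₁ : ℕ} (h2 : D.stretchIdx₃ (D.dpos (D.leftCell₃ ω (orb m₁), D.rightCell₃ ω (orb m₁))) = 2) :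
    ∀ n, m₁ + n < N → (∀ i, i ≤ n → D.rightCell₃ ω (orb (m₁ + i)) ∉ D.verts) →
      D.stretchIdx₃ (D.dpos (D.leftCell₃ ω (orb (m₁ + n)), D.rightCell₃ ω (orb (m₁ + n)))) = 2 := by
  intro n
  induction n with
  | zero => intro _ _; simpa using h2
  | succ n ih =>
    intro hn hout
    have ih' := ih (by omega) (fun i hi => hout i (by omega))
    have hk : m₁ + n + 1 < N := by omega
    have ho := hout n (by omega)
    have ho' := hout (n + 1) le_rfl
    rw [show m₁ + (n + 1) = m₁ + n + 1 by omega] at ho' ⊢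
    have hsucc := (D.cyc_succ_dart horb hleft hk ho).1 ho'
    have hd := (D.cyc_dart_mem_of_not_mem horb hleft (by omega) ho).1
    have hne := (D.cyc_dart_mem_of_not_mem horb hleft hk ho').2
    rw [hsucc] at hne ⊢
    exact D.stretchIdx_succ_eq_two hd ih' hne

include horb hleft in
/-- **A block of outer right cells entered across a dart of `A₂` is left across a dart of `A₂`**:
if `ρₖ ∈ G`, `ρ_{k+1}, …, ρ_{k+n} ∉ G`, `ρ_{k+n+1} ∈ G` and the entry dart `ρₖ → ρ_{k+1}` is in
the stretch `A₂`, then so is the exit dart `ρ_{k+n+1} → ρ_{k+n}`. [folklore] -/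
theorem cyc_block_exit_two {k n : ℕ} (hkn : k + n + 1 < N) (hin : D.rightCell₃ ω (orb k) ∈ D.verts)
    (hout : ∀ i, 1 ≤ i → i ≤ n → D.rightCell₃ ω (orb (k + i)) ∉ D.verts) (hn : 1 ≤ n)
    (hin' : D.rightCell₃ ω (orb (k + n + 1)) ∈ D.verts)
    (h2 : D.stretchIdx₃ (D.dpos (D.rightCell₃ ω (orb k), D.rightCell₃ ω (orb (k + 1)))) = 2) :
    D.stretchIdx₃ (D.dpos (D.rightCell₃ ω (orb (k + n + 1)), D.rightCell₃ ω (orb (k + n)))) = 2 := by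
  have hout1 : D.rightCell₃ ω (orb (k + 1)) ∉ D.verts := hout 1 le_rfl hn
  obtain ⟨hc₁, hsucc₁, -, -⟩ := D.cyc_entry_dart horb hleft (by omega) hin hout1
  -- the first dart from the left cell is in `A₂`
  have hfirst : D.stretchIdx₃ (D.dpos (D.leftCell₃ ω (orb (k + 1)), D.rightCell₃ ω (orb (k + 1)))) = 2 := by
    rw [← hsucc₁]
    exact D.stretchIdx_succ_eq_two hc₁ h2 (by
      rw [hsucc₁]; exact (D.cyc_dart_mem_of_not_mem horb hleft (by omega) hout1).2)
  -- hence all of them, up to `k + n`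
  have hlast := D.cyc_block_stretch_two horb hleft hfirst (n - 1) (by omega) (fun i hi => by
    rw [show k + 1 + i = k + (1 + i) by omega]; exact hout (1 + i) (by omega) (by omega))
  rw [show k + 1 + (n - 1) = k + n by omega] at hlast
  -- and the exit dart is the successor of the last one
  have houtn : D.rightCell₃ ω (orb (k + n)) ∉ D.verts := hout n hn le_rfl
  have hsucc := (D.cyc_succ_dart horb hleft hkn houtn).2 hin'
  rw [hsucc]
  refine D.stretchIdx_succ_eq_two (D.cyc_dart_mem_of_not_mem horb hleft (by omega) houtn).1 hlast ?_
  rw [← hsucc]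
  -- the exit dart is black: in the next face the old right cell is viewed alike from the new
  -- right cell and from the left cell, and from the left cell it is black
  have hF' := D.cyc_succ_eq horb (show k + n < N by omega)
  have hm := D.cyc_faceVertex_oppIdx horb (show k + n < N by omega)
  have hp := D.faceVertex_next_succ₃ (B := ω) (orb (k + n))
  have hq := D.faceVertex_next_succ_succ₃ (B := ω) (orb (k + n))
  rw [← hF'] at hp hq
  set e := oppIdx (orb (k + n)) (D.exitSide₃ ω (orb (k + n))) with he
  have hr : D.rightCell₃ ω (orb (k + n + 1)) = faceVertex (orb (k + n + 1)) e := by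
    rcases D.cyc_cells_succ horb hleft hkn with ⟨hr, -, -, -⟩ | ⟨-, hr, -⟩
    · exact absurd (hr ▸ hin') houtn
    · rw [hr, hm]
  have e30 : e + 2 + 1 = e := by rw [add_assoc]; exact add_eq_left.2 (by decide)
  have e31 : e + 2 + 2 = e + 1 := by rw [add_assoc]; congr 1
  have hviews := D.bdryCol_views_eq₃ (F := orb (k + n + 1)) (j := e + 2) (by rw [hq]; exact houtn)
    (by rw [e30, ← hr]; exact hin') (by rw [e31, hp]; exact hleft (k + n) (by omega))
  rw [e30, e31, hp, hq, ← hr] at hviews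
  have hblack := (D.cyc_dart_mem_of_not_mem horb hleft (show k + n < N by omega) houtn).2
  unfold bdryCol₃ bcolOf₃ at hviews
  intro h0
  rw [h0] at hviews
  simp at hviews
  exact hblack (by simpa using hviews)

include horb hleft in
/-- The left cells along the walk are closed. [folklore] -/
theorem cyc_leftCell_not_mem {k : ℕ} (hk : k < N) : D.leftCell₃ ω (orb k) ∉ ω := by
  obtain ⟨j, hj⟩ := D.cyc_exists_isExit horb hk
  exact D.leftCell_not_mem₃ hj (hleft k hk)

include horb hleft in
/-- **The walk never crosses the chord loop of an open path**: the label of its faces with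
respect to the chord loop of any path of open sites is constant (each step crosses a bond with
a closed endpoint in `G`, which is neither a bond of the path, nor one of the two connecting
bonds — their ends in `G` are open — nor a bond between outer heads). [folklore] -/
theorem cyc_faceLabel_chordLoop_eq {Q' : List (Site 2)} (hQ'ne : Q' ≠ []) (hQ'ω : ∀ s ∈ Q', s ∈ ω)
    (nv' len' : ℕ) (hadj : ∀ d ∈ cycDarts (D.chordLoop Q' nv' len'), triGraph.Adj d.1 d.2) :
    ∀ k ≤ N, faceLabel (cycDarts (D.chordLoop Q' nv' len')) (orb k) =
      faceLabel (cycDarts (D.chordLoop Q' nv' len')) (orb 0) := by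
  intro k
  induction k with
  | zero => intro; rfl
  | succ k ih =>
    intro hk
    rw [← ih (by omega), D.cyc_succ_eq horb (show k < N by omega)]
    have hrule := faceLabel_add_faceLabel_oppFace hadj (orb k) (D.exitSide₃ ω (orb k))
    have hℓG := hleft k (by omega)
    have hℓω := D.cyc_leftCell_not_mem horb hleft (show k < N by omega)
    have h0 : lbond (cycDarts (D.chordLoop Q' nv' len')) (faceVertex (orb k) (D.exitSide₃ ω (orb k) + 1))
        (faceVertex (orb k) (D.exitSide₃ ω (orb k) + 2)) = 0 := by
      refine lbond_eq_zero_of_forall_sym2_ne fun d hd he => ?_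
      have hℓ : D.leftCell₃ ω (orb k) ∈ s(d.1, d.2) := by rw [he]; exact Sym2.mem_mk_right _ _
      rw [D.cycDarts_chordLoop hQ'ne, List.mem_append, List.mem_cons, List.mem_append, List.mem_singleton] at hd
      rcases hd with hd | rfl | hd | rfl
      · obtain ⟨h1, h2⟩ := mem_of_mem_pathDarts hd
        rcases Sym2.mem_iff.1 hℓ with h | h
        · exact hℓω (h ▸ hQ'ω _ h1)
        · exact hℓω (h ▸ hQ'ω _ h2)
      · rcases Sym2.mem_iff.1 hℓ with h | h
        · exact hℓω (h ▸ hQ'ω _ (List.getLast_mem hQ'ne))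
        · exact D.bdryHead_not_mem nv' (by simp only at h; rw [← h]; exact hℓG)
      · obtain ⟨r', -, -, -, rfl⟩ := D.mem_pathDarts_headsList hd
        rcases Sym2.mem_iff.1 hℓ with h | h
        · exact D.bdryHead_not_mem r' (by simp only at h; rw [← h]; exact hℓG)
        · exact D.bdryHead_not_mem (r' + 1) (by simp only at h; rw [← h]; exact hℓG)
      · rcases Sym2.mem_iff.1 hℓ with h | h
        · exact D.bdryHead_not_mem (nv' + len') (by simp only at h; rw [← h]; exact hℓG)
        · exact hℓω (h ▸ hQ'ω _ (List.head_mem hQ'ne))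
    rw [h0] at hrule
    have key : ∀ a b : ZMod 2, a + b = 0 → b = a := by decide
    exact key _ _ hrule

include horb hleft in
/-- **The necklace walk**: the right cells `ρᵣ, …, ρₛ`, when sites of `G`, are successively
equal or adjacent, so they carry a walk of `𝕋` from `ρᵣ` to `ρₛ` whose darts are the pairs
`(ρₖ, ρₖ₊₁)` of distinct consecutive right cells. [cite: BollobasRiordan2006, Ch. 7 Claim 10 p. 178 ("`hᵢ` is adjacent to `hᵢ₊₁` for each `i`")] -/
theorem cyc_exists_necklace_walk (r : ℕ) :
    ∀ n, r + n < N → ∃ W : triGraph.Walk (D.rightCell₃ ω (orb r)) (D.rightCell₃ ω (orb (r + n))),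
      (∀ x ∈ W.support, ∃ k, r ≤ k ∧ k ≤ r + n ∧ x = D.rightCell₃ ω (orb k)) ∧
      (∀ d ∈ W.darts, ∃ k, r ≤ k ∧ k < r + n ∧ D.rightCell₃ ω (orb k) ≠ D.rightCell₃ ω (orb (k + 1)) ∧
        d.toProd = (D.rightCell₃ ω (orb k), D.rightCell₃ ω (orb (k + 1)))) := by
  intro n
  induction n with
  | zero =>
    intro _
    exact ⟨SimpleGraph.Walk.nil, fun x hx => ⟨r, le_rfl, by omega, by simpa using hx⟩, fun d hd => by simp at hd⟩
  | succ n ih =>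
    intro hn
    obtain ⟨W, hWs, hWd⟩ := ih (by omega)
    rw [show r + (n + 1) = r + n + 1 by omega]
    by_cases heq : D.rightCell₃ ω (orb (r + n + 1)) = D.rightCell₃ ω (orb (r + n))
    · refine ⟨W.copy rfl heq.symm, fun x hx => ?_, fun d hd => ?_⟩
      · rw [SimpleGraph.Walk.support_copy] at hx
        obtain ⟨k, h1, h2, h3⟩ := hWs x hx
        exact ⟨k, h1, by omega, h3⟩
      · rw [SimpleGraph.Walk.darts_copy] at hd
        obtain ⟨k, h1, h2, h3, h4⟩ := hWd d hd
        exact ⟨k, h1, by omega, h3, h4⟩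
    · -- adjacent: the right cell changed, to the apex
      have hadj : triGraph.Adj (D.rightCell₃ ω (orb (r + n))) (D.rightCell₃ ω (orb (r + n + 1))) := by
        have hn' : r + n + 1 < N := by omega
        rcases D.cyc_cells_succ horb hleft hn' with ⟨hr, -, -, -⟩ | ⟨-, hr, -⟩
        · exact absurd hr heq
        · have e : D.rightCell₃ ω (orb (r + n + 1)) =
              triLeftApex (D.leftCell₃ ω (orb (r + n))) (D.rightCell₃ ω (orb (r + n))) := hr
          rw [e]
          exact (triGraph_adj_triLeftApex_right (D.adj_rightCell_leftCell₃ (orb (r + n))).symm).symm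
      refine ⟨W.concat hadj, fun x hx => ?_, fun d hd => ?_⟩
      · rw [SimpleGraph.Walk.support_concat, List.mem_append, List.mem_singleton] at hx
        rcases hx with hx | rfl
        · obtain ⟨k, h1, h2, h3⟩ := hWs x hx
          exact ⟨k, h1, by omega, h3⟩
        · exact ⟨r + n + 1, by omega, le_rfl, rfl⟩
      · rw [SimpleGraph.Walk.darts_concat, List.concat_eq_append, List.mem_append, List.mem_singleton] at hd
        rcases hd with hd | rfl
        · obtain ⟨k, h1, h2, h3, h4⟩ := hWd d hd
          exact ⟨k, h1, by omega, h3, h4⟩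
        · exact ⟨r + n, by omega, by omega, fun h => heq h.symm, rfl⟩

end CycleFacts

/-! ### The contradiction from an admissible path using a necklace bond backwards -/

section Reversed

variable (D : TriMarkedDomain 3) {ω : Set (Site 2)} {w : HexVertex} {orb : ℕ → HexVertex} {N : ℕ}
  (horb : ∀ k < N, D.ifaceNext₃ ω (orb k) = some (orb (k + 1)))
  (hleft : ∀ k < N, D.leftCell₃ ω (orb k) ∈ D.verts) (hw0 : orb 0 = w)

include horb hleft hw0 in
/-- **An admissible open path traversing a necklace bond backwards separates `w` from `A₀`** —
contradicting the hypothesis that no admissible path does. The face of the walk at which the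
right cell turns from `p` to `q` is the face left of `p → q`, i.e. right of the path's dart
`q → p`, so its label with respect to the path's chord loop is `leftLabel + 1`; the walk never
crosses that loop, so `w` has the same label; but `w` is joined off the path to a face of `A₀`,
of label `leftLabel` (`faceLabel_eq_leftLabel_of_stretch_zero`). [cite: BollobasRiordan2006, Ch. 7 Claim 10 pp. 178–179] -/
theorem cyc_false_of_reversed_dart {P' : List (Site 2)} (hP'ne : P' ≠ []) (hP'nd : P'.Nodup)
    (hP'ch : List.IsChain triGraph.Adj P') (hP'G : ∀ s ∈ P', s ∈ D.verts) (hP'ω : ∀ s ∈ P', s ∈ ω) (hP'2 : 2 ≤ P'.length)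
    {nu' nv' : ℕ} (hnu1 : D.pos 1 ≤ nu') (hnu2 : nu' < D.pos 2) (hnv2 : D.pos 2 ≤ nv')
    (hnvL : nv' < #(triBdryDarts D.verts))
    (hhead : P'.head hP'ne = (triBdryIter D.verts D.base nu').1)
    (hlast : P'.getLast hP'ne = (triBdryIter D.verts D.base nv').1)
    (hnotw : ∀ Q' : List (Site 2), (hne : Q' ≠ []) → Q'.Nodup → List.IsChain triGraph.Adj Q' →
      (∀ s ∈ Q', s ∈ D.verts ∧ s ∈ ω) → Q'.head hne ∈ D.arc 1 → Q'.getLast hne ∈ D.arc 2 →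
      ¬ Separates D.verts {e : Sym2 (Site 2) | ∃ d ∈ pathDarts Q', e = s(d.1, d.2)} w (D.stretch 0))
    {i : ℕ} (hi : i + 1 ≤ N) {p q : Site 2} (hface : orb (i + 1) = leftFace p q) (hdart : (q, p) ∈ pathDarts P') :
    False := by
  set L := #(triBdryDarts D.verts) with hL
  have hlen : nv' + (nu' + L - nv') = nu' + L := by omega
  have hC' := D.isTriLoop_chordLoop_frame hP'ne hP'nd hP'ch hP'G hP'2 hnu2 hnv2 hnvL hhead hlast
  set C' := D.chordLoop P' nv' (nu' + L - nv') with hC'def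
  -- `w` is joined off `P'` to a face of `A₀`
  have hu : P'.head hP'ne ∈ D.arc 1 := by
    rw [hhead]
    have := D.iter_fst_mem_arc₃ nu'
    have hs : D.stretchIdx₃ nu' = 1 := by
      unfold stretchIdx₃; rw [Nat.mod_eq_of_lt (by omega), if_neg (by omega), if_pos hnu2]
    rwa [hs] at this
  have hv : P'.getLast hP'ne ∈ D.arc 2 := by
    rw [hlast]
    have := D.iter_fst_mem_arc₃ nv'
    have hs : D.stretchIdx₃ nv' = 2 := by
      have h12 := D.pos_lt_pos₃ (show (1 : Fin 3) < 2 by decide)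
      unfold stretchIdx₃; rw [Nat.mod_eq_of_lt hnvL, if_neg (by omega), if_neg (by omega)]
    rwa [hs] at this
  have hns := hnotw P' hP'ne hP'nd hP'ch (fun s hs => ⟨hP'G s hs, hP'ω s hs⟩) hu hv
  unfold Separates at hns
  push Not at hns
  obtain ⟨F, hF, hreach⟩ := hns
  have hπw : faceLabel (cycDarts C') w = leftLabel C' := by
    rw [D.faceLabel_chordLoop_eq_of_reflTransGen hP'ne hC' hreach]
    exact D.faceLabel_eq_leftLabel_of_stretch_zero hP'ne hP'G hnu1 hnu2 hnv2 hnvL hlen hC' hF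
  -- the walk never crosses `C'`
  have hinv := D.cyc_faceLabel_chordLoop_eq horb hleft hP'ne hP'ω nv' (nu' + L - nv') hC'.adj (i + 1) hi
  rw [hw0, hπw, hface] at hinv
  -- the face left of `p → q` is right of the dart `q → p` of `P'`
  have hright := hC'.faceLabel_rightFace (D.mem_cycDarts_chordLoop_of_mem_pathDarts (nv := nv') hP'ne (nu' + L - nv') hdart)
  simp only at hright
  rw [hright] at hinv
  have key : ∀ a : ZMod 2, a + 1 ≠ a := by decide
  exact key _ hinv

end Reversed

/-! ### Darts of `A₁` out of `v₂` -/

section MarkTwo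

variable (D : TriMarkedDomain 3)

/-- **The only dart of the stretch `A₁` out of `v₂` is the one just before its marked dart**:
the darts out of `v₂` form one block starting at `pos 2 - 1` (`mark_pred`, `mark_pred_pred`,
`tail_not_interleaved` with the dart of `v₀` at the last position). [folklore] -/
theorem dpos_eq_of_fst_eq_markSite_two {d : Site 2 × Site 2} (hd : d ∈ triBdryDarts D.verts)
    (h1 : d.1 = D.markSite 2) (hs : D.stretchIdx₃ (D.dpos d) = 1) : D.dpos d = D.pos 2 - 1 := by
  set L := #(triBdryDarts D.verts) with hL
  have hlt := D.dpos_lt hd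
  have h01 := D.pos_lt_pos₃ (show (0 : Fin 3) < 1 by decide)
  have h12 := D.pos_lt_pos₃ (show (1 : Fin 3) < 2 by decide)
  have h2L := D.pos_lt 2
  have hz : D.pos 0 = 0 := D.pos_zero (by decide)
  -- the position is in `[pos 1, pos 2)`
  have hq : D.pos 1 ≤ D.dpos d ∧ D.dpos d < D.pos 2 := by
    unfold stretchIdx₃ at hs
    rw [Nat.mod_eq_of_lt hlt] at hs
    by_cases ha : D.dpos d < D.pos 1
    · rw [if_pos ha] at hs; exact absurd hs (by decide)
    · rw [if_neg ha] at hs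
      by_cases hb : D.dpos d < D.pos 2
      · exact ⟨by omega, hb⟩
      · rw [if_neg hb] at hs; exact absurd hs (by decide)
  have hdq : (triBdryIter D.verts D.base (D.dpos d)).1 = D.markSite 2 := by rw [D.iter_dpos hd]; exact h1
  -- tails: `pos 2 - 1 ↦ v₂`, `pos 2 - 2 ↦ ≠ v₂`, `L - 1 ↦ v₀ ≠ v₂`
  have hp1 : (triBdryIter D.verts D.base (D.pos 2 - 1)).1 = D.markSite 2 := by
    have := D.mark_pred 2
    rw [show D.pos 2 + (L - 1) = (D.pos 2 - 1) + L by omega, D.iter_add_card] at this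
    exact this
  have hp2 : (triBdryIter D.verts D.base (D.pos 2 - 2)).1 ≠ D.markSite 2 := by
    have := D.mark_pred_pred 2
    rw [show D.pos 2 + (L - 2) = (D.pos 2 - 2) + L by omega, D.iter_add_card] at this
    exact this
  have hpL : (triBdryIter D.verts D.base (L - 1)).1 ≠ D.markSite 2 := by
    have := D.mark_pred 0
    rw [hz, zero_add] at this
    rw [this]
    intro e
    have := D.mark_injective (show (triBdryIter D.verts D.base (D.pos 0)).1 = (triBdryIter D.verts D.base (D.pos 2)).1 by
      rw [hz]; exact e)
    exact absurd this (by decide)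
  by_contra hne
  rcases Nat.lt_or_ge (D.dpos d) (D.pos 2 - 2) with hlt' | hge
  · -- interleaved: `q < pos 2 - 2 < pos 2 - 1 < L - 1`
    rcases D.tail_not_interleaved D.base_mem (n₁ := D.dpos d) (n₂ := D.pos 2 - 2) (n₃ := D.pos 2 - 1) (n₄ := L - 1)
        hlt' (by omega) (by omega) (by omega) hdq hp1 with h | h
    · exact hp2 h
    · exact hpL h
  · have : D.dpos d = D.pos 2 - 2 := by omega
    rw [this] at hdq
    exact hp2 hdq

end MarkTwo

/-! ### The main case: a necklace segment between an `A₂`-anchor and an `A₁`-anchor -/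

section Main

variable (D : TriMarkedDomain 3) {ω : Set (Site 2)} {w : HexVertex} {orb : ℕ → HexVertex} {N : ℕ}
  (horb : ∀ k < N, D.ifaceNext₃ ω (orb k) = some (orb (k + 1)))
  (hleft : ∀ k < N, D.leftCell₃ ω (orb k) ∈ D.verts) (hw0 : orb 0 = w)

include horb hleft hw0 in
/-- **The main case of the cycle.** Between an index `r` whose right cell is on the final part
`x₂ ⋯ v` of the path or is the tail of a dart of `A₂`, and a later index `s` whose right cell is
on the initial part `u ⋯ x₁` or is the tail of a dart of `A₁`, with all right cells strictly
between in `G` and off the path, and `ρᵣ ≠ ρₛ`: the necklace walk from `ρᵣ` to `ρₛ`, made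
simple and reversed, spliced between the path up to `ρₛ` and the path from `ρᵣ`, is an
admissible open path traversing a necklace bond backwards (`cyc_false_of_reversed_dart`). [cite: BollobasRiordan2006, Ch. 7 Claim 10 pp. 178–179] -/
theorem cyc_main_false {Q L₁ L₂ : List (Site 2)} {a b : Site 2} (hQeq : Q = L₁ ++ a :: b :: L₂) (hQnd : Q.Nodup)
    (hQch : List.IsChain triGraph.Adj Q) (hQG : ∀ s ∈ Q, s ∈ D.verts) (hQω : ∀ s ∈ Q, s ∈ ω)
    {nu nv : ℕ} (hnu1 : D.pos 1 ≤ nu) (hnu2 : nu < D.pos 2) (hnv2 : D.pos 2 ≤ nv) (hnvL : nv < #(triBdryDarts D.verts))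
    (hQhead : Q.head (by rw [hQeq]; simp) = (triBdryIter D.verts D.base nu).1)
    (hQlast : Q.getLast (by rw [hQeq]; simp) = (triBdryIter D.verts D.base nv).1)
    (hnotw : ∀ Q' : List (Site 2), (hne : Q' ≠ []) → Q'.Nodup → List.IsChain triGraph.Adj Q' →
      (∀ s ∈ Q', s ∈ D.verts ∧ s ∈ ω) → Q'.head hne ∈ D.arc 1 → Q'.getLast hne ∈ D.arc 2 →
      ¬ Separates D.verts {e : Sym2 (Site 2) | ∃ d ∈ pathDarts Q', e = s(d.1, d.2)} w (D.stretch 0))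
    {r s : ℕ} (hrs : r < s) (hsN : s < N)
    (hmidG : ∀ k, r ≤ k → k ≤ s → D.rightCell₃ ω (orb k) ∈ D.verts)
    (hmidQ : ∀ k, r < k → k < s → D.rightCell₃ ω (orb k) ∉ Q)
    (hne : D.rightCell₃ ω (orb r) ≠ D.rightCell₃ ω (orb s))
    (hsA : D.rightCell₃ ω (orb s) ∈ L₁ ++ [a] ∨ (D.rightCell₃ ω (orb s) ∉ Q ∧
      ∃ nu', D.pos 1 ≤ nu' ∧ nu' < D.pos 2 ∧ D.rightCell₃ ω (orb s) = (triBdryIter D.verts D.base nu').1))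
    (hrT : D.rightCell₃ ω (orb r) ∈ b :: L₂ ∨ (D.rightCell₃ ω (orb r) ∉ Q ∧
      ∃ nv', D.pos 2 ≤ nv' ∧ nv' < #(triBdryDarts D.verts) ∧ D.rightCell₃ ω (orb r) = (triBdryIter D.verts D.base nv').1)) :
    False := by
  classical
  set L := #(triBdryDarts D.verts) with hL
  set ρ : ℕ → Site 2 := fun k => D.rightCell₃ ω (orb k) with hρ
  obtain ⟨n, rfl⟩ : ∃ n, s = r + n := ⟨s - r, by omega⟩
  -- the necklace walk, made simple
  obtain ⟨W, hWs, hWd⟩ := D.cyc_exists_necklace_walk horb hleft r n hsN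
  set Sw := W.bypass with hSw
  have hSpath : Sw.IsPath := W.bypass_isPath
  have hSsupp : ∀ x ∈ Sw.support, ∃ k, r ≤ k ∧ k ≤ r + n ∧ x = ρ k := fun x hx =>
    hWs x (W.support_bypass_subset_support hx)
  have hSdarts : ∀ d ∈ Sw.darts, ∃ k, r ≤ k ∧ k < r + n ∧ ρ k ≠ ρ (k + 1) ∧ d.toProd = (ρ k, ρ (k + 1)) :=
    fun d hd => hWd d (W.darts_bypass_subset_darts hd)
  -- it has a dart
  have hSne : Sw.darts ≠ [] := by
    intro h0
    have : Sw.length = 0 := by rw [← SimpleGraph.Walk.length_darts, h0, List.length_nil]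
    exact hne (SimpleGraph.Walk.eq_of_length_eq_zero this)
  obtain ⟨d₀, hd₀⟩ := List.exists_mem_of_ne_nil _ hSne
  obtain ⟨i, hir, hin, hρi, hd₀eq⟩ := hSdarts d₀ hd₀
  -- the reversed support
  set Snew := Sw.support.reverse with hSnew
  have hSnew_ne : Snew ≠ [] := by simp [hSnew]
  have hSnew_head : Snew.head hSnew_ne = ρ (r + n) := by
    simp only [hSnew, List.head_reverse, SimpleGraph.Walk.getLast_support]; rfl
  have hSnew_last : Snew.getLast hSnew_ne = ρ r := by
    simp only [hSnew, List.getLast_reverse, SimpleGraph.Walk.head_support]; rfl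
  have hSnew_nd : Snew.Nodup := List.nodup_reverse.2 hSpath.support_nodup
  have hSnew_ch : List.IsChain triGraph.Adj Snew := by
    rw [hSnew, List.isChain_reverse]
    exact Sw.isChain_adj_support.imp fun x y h => h.symm
  have hSnew_dart : (ρ (i + 1), ρ i) ∈ pathDarts Snew := by
    rw [hSnew, mem_pathDarts_reverse, mem_pathDarts_support_iff]
    exact ⟨d₀, hd₀, hd₀eq⟩
  have hface : orb (i + 1) = leftFace (ρ i) (ρ (i + 1)) := by
    have hk : i + 1 < N := by omega
    rcases D.cyc_cells_succ horb hleft hk with ⟨hr', -, -, -⟩ | ⟨-, hr', -⟩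
    · exact absurd hr'.symm hρi
    · rw [D.cyc_succ_eq_leftFace horb (show i < N by omega)]
      have e : ρ (i + 1) = triLeftApex (D.leftCell₃ ω (orb i)) (ρ i) := hr'
      have hadj : triGraph.Adj (D.leftCell₃ ω (orb i)) (ρ i) := (D.adj_rightCell_leftCell₃ (orb i)).symm
      obtain ⟨j, h1, h2⟩ := exists_eq_faceVertex_of_adj hadj
      set F := leftFace (D.leftCell₃ ω (orb i)) (ρ i) with hF
      rw [e, h1, h2, triLeftApex_faceVertex, show j + 2 = j + 1 + 1 by rw [add_assoc]; rfl, leftFace_faceVertex]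
  -- the cells of `Snew`: right cells `ρₖ`, `r ≤ k ≤ r + n`, in `G` and open
  have hSnew_mem : ∀ x ∈ Snew, ∃ k, r ≤ k ∧ k ≤ r + n ∧ x = ρ k := fun x hx =>
    hSsupp x (List.mem_reverse.1 hx)
  have hSnew_Gω : ∀ x ∈ Snew, x ∈ D.verts ∧ x ∈ ω := by
    intro x hx
    obtain ⟨k, h1, h2, rfl⟩ := hSnew_mem x hx
    have hG := hmidG k h1 h2
    obtain ⟨j, hj⟩ := D.cyc_exists_isExit horb (show k < N by omega)
    exact ⟨hG, D.rightCell_mem₃ hj hG⟩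
  have hSnew_len : 2 ≤ Snew.length := by
    rw [hSnew, List.length_reverse, SimpleGraph.Walk.length_support]
    have : 0 < Sw.length := by
      rw [← SimpleGraph.Walk.length_darts]; exact List.length_pos_iff.2 hSne
    omega
  -- the two halves of `Q` are disjoint
  have hQeq' : Q = (L₁ ++ [a]) ++ (b :: L₂) := by rw [hQeq]; simp
  have hdisj : ∀ x, x ∈ L₁ ++ [a] → x ∈ b :: L₂ → False := by
    intro x h1 h2
    have := hQeq' ▸ hQnd
    exact (List.nodup_append.1 this).2.2 x h1 x h2 rfl
  -- the prefix `A'` (sites of `Q` before `ρₛ`) and the suffix `T'` (sites after `ρᵣ`)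
  have hAex : ∃ A' : List (Site 2), (∀ x ∈ A', x ∈ L₁ ++ [a]) ∧ ρ (r + n) ∉ A' ∧
      List.IsChain triGraph.Adj (A' ++ [ρ (r + n)]) ∧ (A' ++ [ρ (r + n)]).Nodup ∧
      (∃ nu', D.pos 1 ≤ nu' ∧ nu' < D.pos 2 ∧ (A' ++ [ρ (r + n)]).head (by simp) = (triBdryIter D.verts D.base nu').1) := by
    rcases hsA with hA | ⟨-, nu', h1, h2, h3⟩
    · obtain ⟨A', A₂, hsplit⟩ := List.append_of_mem hA
      have hQA : Q = (A' ++ [ρ (r + n)]) ++ (A₂ ++ b :: L₂) := by rw [hQeq', hsplit]; simp [hρ]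
      have hndA : (A' ++ [ρ (r + n)]).Nodup := (List.nodup_append.1 (hQA ▸ hQnd)).1
      refine ⟨A', fun x hx => by rw [hsplit]; simp [hx], ?_, (hQA ▸ hQch).left_of_append, hndA, nu, hnu1, hnu2, ?_⟩
      · have := List.nodup_append.1 hndA
        exact fun h => this.2.2 _ h _ (List.mem_singleton_self _) rfl
      · rw [← hQhead]
        have key : ∀ (l : List (Site 2)) (hl : l ≠ []), l = (A' ++ [ρ (r + n)]) ++ (A₂ ++ b :: L₂) →
            (A' ++ [ρ (r + n)]).head (by simp) = l.head hl := by
          intro l hl h; subst h; exact (List.head_append_of_ne_nil (by simp)).symm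
        exact key Q _ hQA
    · exact ⟨[], by simp, by simp, List.isChain_singleton _, List.nodup_singleton _, nu', h1, h2, by simpa using h3⟩
  have hTex : ∃ T' : List (Site 2), (∀ x ∈ T', x ∈ b :: L₂) ∧ ρ r ∉ T' ∧
      List.IsChain triGraph.Adj (ρ r :: T') ∧ (ρ r :: T').Nodup ∧
      (∃ nv', D.pos 2 ≤ nv' ∧ nv' < L ∧ (ρ r :: T').getLast (by simp) = (triBdryIter D.verts D.base nv').1) := by
    rcases hrT with hT | ⟨-, nv', h1, h2, h3⟩
    · obtain ⟨T₂, T', hsplit⟩ := List.append_of_mem hT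
      have hQT : Q = (L₁ ++ [a] ++ T₂) ++ (ρ r :: T') := by rw [hQeq', hsplit]; simp [hρ]
      have hndT : (ρ r :: T').Nodup := (List.nodup_append.1 (hQT ▸ hQnd)).2.1
      refine ⟨T', fun x hx => by rw [hsplit]; simp [hx], (List.nodup_cons.1 hndT).1, (hQT ▸ hQch).right_of_append,
        hndT, nv, hnv2, hnvL, ?_⟩
      rw [← hQlast]
      have key : ∀ (l : List (Site 2)) (hl : l ≠ []), l = (L₁ ++ [a] ++ T₂) ++ (ρ r :: T') →
          (ρ r :: T').getLast (by simp) = l.getLast hl := by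
        intro l hl h; subst h; exact (List.getLast_append_of_right_ne_nil _ _ (by simp)).symm
      exact key Q _ hQT
    · exact ⟨[], by simp, by simp, List.isChain_singleton _, List.nodup_singleton _, nv', h1, h2, by simpa using h3⟩
  obtain ⟨A', hA'sub, hA'ρ, hA'ch, hA'nd, nu', hnu'1, hnu'2, hA'head⟩ := hAex
  obtain ⟨T', hT'sub, hT'ρ, hT'ch, hT'nd, nv', hnv'2, hnv'L, hT'last⟩ := hTex
  -- the spliced path
  set P' := A' ++ Snew ++ T' with hP'
  have hP'ne : P' ≠ [] := by simp [hP', hSnew_ne]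
  -- where its sites come from
  have hP'mem : ∀ x ∈ P', x ∈ A' ∨ x ∈ Snew ∨ x ∈ T' := fun x hx => by simpa [hP', or_assoc] using hx
  refine D.cyc_false_of_reversed_dart horb hleft hw0 hP'ne ?_ ?_ ?_ ?_ ?_ hnu'1 hnu'2 hnv'2 hnv'L ?_ ?_ hnotw
    (i := i) (by omega) hface (p := ρ i) (q := ρ (i + 1)) ?_
  · -- duplicate-free
    rw [hP', List.append_assoc, List.nodup_append]
    refine ⟨(List.nodup_append.1 hA'nd).1, List.nodup_append.2 ⟨hSnew_nd, (List.nodup_cons.1 hT'nd).2, ?_⟩, ?_⟩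
    · intro x hx y hy hxy
      subst hxy
      obtain ⟨k, hk1, hk2, rfl⟩ := hSnew_mem x hx
      by_cases hkr : k = r
      · subst hkr; exact hT'ρ hy
      · by_cases hkn : k = r + n
        · rw [hkn] at hy
          rcases hsA with hA | ⟨hA, -⟩
          · exact hdisj _ hA (hT'sub _ hy)
          · exact hA (by rw [hQeq']; exact List.mem_append_right _ (hT'sub _ hy))
        · exact hmidQ k (by omega) (by omega) (by rw [hQeq']; exact List.mem_append_right _ (hT'sub _ hy))
    · intro x hx y hy hxy
      subst hxy
      rcases List.mem_append.1 hy with hy | hy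
      · obtain ⟨k, hk1, hk2, rfl⟩ := hSnew_mem x hy
        by_cases hkn : k = r + n
        · subst hkn; exact hA'ρ hx
        · by_cases hkr : k = r
          · rw [hkr] at hx
            rcases hrT with hT | ⟨hT, -⟩
            · exact hdisj _ (hA'sub _ hx) hT
            · exact hT (by rw [hQeq']; exact List.mem_append_left _ (hA'sub _ hx))
          · exact hmidQ k (by omega) (by omega) (by rw [hQeq']; exact List.mem_append_left _ (hA'sub _ hx))
      · exact hdisj _ (hA'sub _ hx) (hT'sub _ hy)
  · -- a chain
    rw [hP']
    refine List.IsChain.append (List.IsChain.append ((List.isChain_append.1 hA'ch).1) hSnew_ch ?_)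
      ((List.isChain_cons.1 hT'ch).2) ?_
    · intro x hx y hy
      rw [List.head?_eq_some_head hSnew_ne, Option.mem_def, Option.some.injEq] at hy
      subst hy
      rw [hSnew_head]
      exact (List.isChain_append.1 hA'ch).2.2 x hx _ (by simp)
    · intro x hx y hy
      rw [List.getLast?_eq_some_getLast (by simp [hSnew_ne]), Option.mem_def, Option.some.injEq] at hx
      subst hx
      rw [List.getLast_append_of_right_ne_nil _ _ hSnew_ne, hSnew_last]
      exact (List.isChain_cons.1 hT'ch).1 y hy
  · -- sites of `G`
    intro x hx
    rcases hP'mem x hx with h | h | h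
    · exact hQG _ (by rw [hQeq']; exact List.mem_append_left _ (hA'sub _ h))
    · exact (hSnew_Gω x h).1
    · exact hQG _ (by rw [hQeq']; exact List.mem_append_right _ (hT'sub _ h))
  · -- open
    intro x hx
    rcases hP'mem x hx with h | h | h
    · exact hQω _ (by rw [hQeq']; exact List.mem_append_left _ (hA'sub _ h))
    · exact (hSnew_Gω x h).2
    · exact hQω _ (by rw [hQeq']; exact List.mem_append_right _ (hT'sub _ h))
  · -- at least two sites
    rw [hP', List.length_append, List.length_append]; omega
  · -- the start
    rw [← hA'head]
    simp only [hP', List.append_assoc]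
    cases A' with
    | nil => simp only [List.nil_append, List.head_cons]; rw [List.head_append_of_ne_nil hSnew_ne, hSnew_head]
    | cons y ys => rfl
  · -- the end
    rw [← hT'last]
    simp only [hP']
    by_cases hT0 : T' = []
    · subst hT0
      simp only [List.append_nil, List.getLast_singleton]
      rw [List.getLast_append_of_right_ne_nil _ _ hSnew_ne, hSnew_last]
    · simp only [List.getLast_append_of_right_ne_nil _ _ hT0, List.getLast_cons hT0]
  · -- the reversed necklace dart
    rw [hP', List.append_assoc]
    by_cases hA0 : A' = []
    · rw [hA0, List.nil_append]
      by_cases hT0 : T' = []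
      · rw [hT0, List.append_nil]; exact hSnew_dart
      · rw [pathDarts_append hSnew_ne hT0]; exact List.mem_append_left _ hSnew_dart
    · rw [pathDarts_append hA0 (by simp [hSnew_ne])]
      refine List.mem_append_right _ (List.mem_cons_of_mem _ ?_)
      by_cases hT0 : T' = []
      · rw [hT0, List.append_nil]; exact hSnew_dart
      · rw [pathDarts_append hSnew_ne hT0]; exact List.mem_append_left _ hSnew_dart

end Main

/-! ### Where the walk may touch the black boundary -/

section Contacts

variable (D : TriMarkedDomain 3) {ω : Set (Site 2)} {w : HexVertex} {orb : ℕ → HexVertex} {N : ℕ}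
  (horb : ∀ k < N, D.ifaceNext₃ ω (orb k) = some (orb (k + 1)))
  (hleft : ∀ k < N, D.leftCell₃ ω (orb k) ∈ D.verts) (hw0 : orb 0 = w)
  {Q : List (Site 2)} (hQne : Q ≠ []) (hQG : ∀ s ∈ Q, s ∈ D.verts) (hQω : ∀ s ∈ Q, s ∈ ω)
  {nu nv : ℕ} (hlt : nu < nv) (hnvL : nv < #(triBdryDarts D.verts))
  (hQhead : Q.head hQne = (triBdryIter D.verts D.base nu).1)
  (hQlast : Q.getLast hQne = (triBdryIter D.verts D.base nv).1)
  (hC : IsTriLoop (D.chordLoop Q nv (nu + #(triBdryDarts D.verts) - nv)))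
  (hπw : faceLabel (cycDarts (D.chordLoop Q nv (nu + #(triBdryDarts D.verts) - nv))) w =
    leftLabel (D.chordLoop Q nv (nu + #(triBdryDarts D.verts) - nv)))

include horb hleft hw0 hQne hQG hQω hlt hnvL hQhead hQlast hC hπw in
/-- **The walk touches the black boundary only beyond the ends of the path**: at a step whose
right cell is an outer cell, the boundary dart from the left cell is not at a position in
`[nᵤ, nᵥ)` — the next face is the face left of that dart, of label `leftLabel + 1` there
(`faceLabel_eq_leftLabel_add_one_of_mem_Ico`), while all faces of the walk have the label of
`w`, `leftLabel`. [folklore] -/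
theorem cyc_outer_pos {k : ℕ} (hk : k < N) (hout : D.rightCell₃ ω (orb k) ∉ D.verts) :
    ¬ (nu ≤ D.dpos (D.leftCell₃ ω (orb k), D.rightCell₃ ω (orb k)) ∧
      D.dpos (D.leftCell₃ ω (orb k), D.rightCell₃ ω (orb k)) + 1 ≤ nv) := by
  rintro ⟨h1, h2⟩
  set L := #(triBdryDarts D.verts) with hL
  have hd := (D.cyc_dart_mem_of_not_mem horb hleft hk hout).1
  set q := D.dpos (D.leftCell₃ ω (orb k), D.rightCell₃ ω (orb k)) with hq
  have hiter : triBdryIter D.verts D.base q = (D.leftCell₃ ω (orb k), D.rightCell₃ ω (orb k)) := D.iter_dpos hd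
  have hγ := D.faceLabel_eq_leftLabel_add_one_of_mem_Ico hQne hQG hlt (by omega) (by omega) hQlast
    (by rw [show nv + (nu + L - nv) = nu + L by omega, D.iter_add_card]; exact hQhead) hC h1 h2
  have hface : orb (k + 1) = leftFace (triBdryIter D.verts D.base q).1 (D.bdryHead q) := by
    rw [D.cyc_succ_eq_leftFace horb hk]
    unfold bdryHead
    rw [hiter]
  have hinv := D.cyc_faceLabel_chordLoop_eq horb hleft hQne hQω nv (nu + L - nv) hC.adj (k + 1) hk
  rw [hw0, hπw, hface, hγ] at hinv
  have key : ∀ a : ZMod 2, a + 1 ≠ a := by decide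
  exact key _ hinv

include horb hleft hw0 hQne hQG hQω hlt hnvL hQhead hQlast hC hπw in
/-- **A contact with `A₁` happens below `u`**: if the right cell `ρₖ ∈ G` is followed by an outer
right cell seen across a dart of `A₁`, that dart is at a position `n'` with `n' + 1 < nᵤ`. [folklore] -/
theorem cyc_one_contact_pos (hnv2 : D.pos 2 ≤ nv) (hv : (triBdryIter D.verts D.base nv).1 ∈ ω) {k : ℕ} (hk : k + 1 < N)
    (hin : D.rightCell₃ ω (orb k) ∈ D.verts) (hout : D.rightCell₃ ω (orb (k + 1)) ∉ D.verts)
    (h1 : D.stretchIdx₃ (D.dpos (D.rightCell₃ ω (orb k), D.rightCell₃ ω (orb (k + 1)))) = 1) :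
    D.dpos (D.rightCell₃ ω (orb k), D.rightCell₃ ω (orb (k + 1))) + 1 < nu := by
  set L := #(triBdryDarts D.verts) with hL
  obtain ⟨hc, hsucc, -, -⟩ := D.cyc_entry_dart horb hleft hk hin hout
  set n' := D.dpos (D.rightCell₃ ω (orb k), D.rightCell₃ ω (orb (k + 1))) with hn'
  have hlt' := D.dpos_lt hc
  have h12 := D.pos_lt_pos₃ (show (1 : Fin 3) < 2 by decide)
  have h2 : n' + 1 ≤ D.pos 2 := by
    unfold stretchIdx₃ at h1
    rw [Nat.mod_eq_of_lt hlt'] at h1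
    by_contra hge
    rw [if_neg (by omega), if_neg (by omega)] at h1
    exact absurd h1 (by decide)
  -- the dart from the left cell of the next face is the successor, at position `n' + 1`
  have hq : D.dpos (D.leftCell₃ ω (orb (k + 1)), D.rightCell₃ ω (orb (k + 1))) = n' + 1 := by
    rw [← hsucc, D.dpos_succ hc, Nat.mod_eq_of_lt (by have := D.pos_lt 2; omega)]
  have hpos := D.cyc_outer_pos horb hleft hw0 hQne hQG hQω hlt hnvL hQhead hQlast hC hπw hk hout
  rw [hq] at hpos
  by_contra hge
  push Not at hge
  have hnv : n' + 1 + 1 > nv := by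
    by_contra h'; push Not at h'; exact hpos ⟨hge, h'⟩
  -- then `n' + 1 = nᵥ` and the left cell would be `v`, open
  have heq : n' + 1 = nv := by omega
  have hd := (D.cyc_dart_mem_of_not_mem horb hleft hk hout).1
  have hiter := D.iter_dpos hd
  rw [hq, heq] at hiter
  have hℓ : D.leftCell₃ ω (orb (k + 1)) = (triBdryIter D.verts D.base nv).1 := by rw [hiter]
  exact D.cyc_leftCell_not_mem horb hleft hk (hℓ ▸ hv)

include horb hleft hw0 hQne hQG hQω hlt hnvL hQhead hQlast hC hπw in
/-- **A contact with `A₂` happens beyond `v`**: if the right cell `ρₖ ∈ G` is preceded by an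
outer right cell seen across a dart of `A₂`, that dart is at a position `n'' > nᵥ`. [folklore] -/
theorem cyc_two_contact_pos (hnu2 : nu < D.pos 2) {k : ℕ} (hk : k + 1 < N)
    (hout : D.rightCell₃ ω (orb k) ∉ D.verts) (hin : D.rightCell₃ ω (orb (k + 1)) ∈ D.verts)
    (h2 : D.stretchIdx₃ (D.dpos (D.rightCell₃ ω (orb (k + 1)), D.rightCell₃ ω (orb k))) = 2) :
    nv < D.dpos (D.rightCell₃ ω (orb (k + 1)), D.rightCell₃ ω (orb k)) := by
  set L := #(triBdryDarts D.verts) with hL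
  have hsucc := (D.cyc_succ_dart horb hleft hk hout).2 hin
  have hd := (D.cyc_dart_mem_of_not_mem horb hleft (show k < N by omega) hout).1
  set q := D.dpos (D.leftCell₃ ω (orb k), D.rightCell₃ ω (orb k)) with hq
  have hqlt := D.dpos_lt hd
  have h12 := D.pos_lt_pos₃ (show (1 : Fin 3) < 2 by decide)
  have hn'' : D.dpos (D.rightCell₃ ω (orb (k + 1)), D.rightCell₃ ω (orb k)) = (q + 1) % L := by
    rw [hsucc, D.dpos_succ hd]
  rw [hn''] at h2 ⊢
  -- `(q + 1) % L ∈ [pos 2, L)`, so no wrap: `= q + 1`, and `q ≥ pos 2 - 1 ≥ nᵤ`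
  have hge : D.pos 2 ≤ (q + 1) % L := by
    unfold stretchIdx₃ at h2
    rw [Nat.mod_mod] at h2
    by_contra hlt'
    push Not at hlt'
    by_cases ha : (q + 1) % L < D.pos 1
    · rw [if_pos ha] at h2; exact absurd h2 (by decide)
    · rw [if_neg ha, if_pos hlt'] at h2; exact absurd h2 (by decide)
  have hnowrap : (q + 1) % L = q + 1 := by
    by_contra hw
    have : q + 1 = L := by
      by_contra hne; exact hw (Nat.mod_eq_of_lt (by omega))
    rw [this, Nat.mod_self] at hge
    have := D.pos_lt_pos₃ (show (0 : Fin 3) < 2 by decide); omega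
  rw [hnowrap] at hge ⊢
  have hpos := D.cyc_outer_pos horb hleft hw0 hQne hQG hQω hlt hnvL hQhead hQlast hC hπw (show k < N by omega) hout
  by_contra hle
  push Not at hle
  exact hpos ⟨by omega, by omega⟩

end Contacts

/-! ### No site of `G` off the path touches `A₁` below `u` and `A₂` beyond `v` -/

section TwoSided

variable (D : TriMarkedDomain 3)

/-- **No site other than the tail at `nᵤ` is the tail of a boundary dart before `nᵤ` (from
`pos 1` on) and of one after `nᵤ`**: its darts would be interleaved with those of the tail at
`nᵤ` and of `v₁` (or `v₀`) (`tail_not_interleaved`). [folklore] -/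
theorem false_of_two_sided {c : Site 2} {n' n'' nu : ℕ} (hn' : D.pos 1 ≤ n') (h1 : n' < nu)
    (h2 : nu < n'') (hn''L : n'' < #(triBdryDarts D.verts))
    (ht' : (triBdryIter D.verts D.base n').1 = c) (ht'' : (triBdryIter D.verts D.base n'').1 = c)
    (hcu : (triBdryIter D.verts D.base nu).1 ≠ c) : False := by
  set L := #(triBdryDarts D.verts) with hL
  have hz : D.pos 0 = 0 := D.pos_zero (by decide)
  have h01 := D.pos_lt_pos₃ (show (0 : Fin 3) < 1 by decide)
  have hv0 : (triBdryIter D.verts D.base (L - 1)).1 = D.markSite 0 := by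
    have := D.mark_pred 0
    rw [hz, zero_add] at this
    rw [this]
    show (triBdryIter D.verts D.base 0).1 = (triBdryIter D.verts D.base (D.pos 0)).1
    rw [hz]
  have hv1 : (triBdryIter D.verts D.base (D.pos 1 + (L - 1))).1 = D.markSite 1 := D.mark_pred 1
  have h01ne : D.markSite 0 ≠ D.markSite 1 := fun e => absurd (D.mark_injective e) (by decide)
  by_cases hc1 : c = D.markSite 1
  · -- `c = v₁`: darts at `pos 1 < nᵤ < n'' < L - 1`
    have hp1 : D.pos 1 < nu := by
      by_contra hle
      have : nu = D.pos 1 := by omega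
      exact hcu (by rw [this, hc1]; rfl)
    have hn''lt : n'' < L - 1 := by
      by_contra hle
      have : n'' = L - 1 := by omega
      rw [this, hv0] at ht''
      exact h01ne (ht''.trans hc1)
    rcases D.tail_not_interleaved D.base_mem (u := c) (n₁ := D.pos 1) (n₂ := nu) (n₃ := n'') (n₄ := L - 1)
        hp1 (by omega) hn''lt (by omega) (by rw [hc1]; rfl) ht'' with h | h
    · exact hcu h
    · rw [hv0] at h; exact h01ne (h.trans hc1)
  · -- `c ≠ v₁`: read from the marked dart of `v₁`, darts at `n' - pos 1 < nᵤ - pos 1 < n'' - pos 1 < L - 1`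
    have hb : triBdryIter D.verts D.base (D.pos 1) ∈ triBdryDarts D.verts := triBdryIter_mem D.base_mem _
    have hsh : ∀ m, triBdryIter D.verts (triBdryIter D.verts D.base (D.pos 1)) m = triBdryIter D.verts D.base (D.pos 1 + m) :=
      fun m => (triBdryIter_add _ _ _ _).symm
    rcases D.tail_not_interleaved hb (u := c) (n₁ := n' - D.pos 1) (n₂ := nu - D.pos 1) (n₃ := n'' - D.pos 1)
        (n₄ := L - 1) (by omega) (by omega) (by omega) (by omega)
        (by rw [hsh, show D.pos 1 + (n' - D.pos 1) = n' by omega]; exact ht')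
        (by rw [hsh, show D.pos 1 + (n'' - D.pos 1) = n'' by omega]; exact ht'') with h | h
    · rw [hsh, show D.pos 1 + (nu - D.pos 1) = nu by omega] at h; exact hcu h
    · rw [hsh, hv1] at h; exact hc1 h.symm

end TwoSided

/-! ### The degenerate contacts: a bump of the path against the boundary -/

section Bump

variable (D : TriMarkedDomain 3) {ω : Set (Site 2)} {w : HexVertex}

/-- **The bump lemma.** Let the path `Q` be the union of a "bump" `B` and an admissible path
`P°` sharing one endpoint, with `w` to the left of a dart of `B`, and let the chord loop `Π` of
the bump (closed outside along the heads between its ends) be a lattice loop of sites of `G`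
having every face of `A₀` on its right. Then `P°` separates `w` from `A₀` — contradiction: along
a dual path from `w` to `A₀` not crossing `P°`, the labels with respect to the chord loop of `Q`
and to `Π` change together (exactly at the bonds of `B`); the former is `leftLabel` at both
ends, the latter is `leftLabel Π` at `w` and `leftLabel Π + 1` at the far end. [folklore] -/
theorem false_of_bump {Q : List (Site 2)} (hQne : Q ≠ []) (hQG : ∀ s ∈ Q, s ∈ D.verts)
    {nu nv : ℕ} (hnu1 : D.pos 1 ≤ nu) (hnu2 : nu < D.pos 2) (hnv2 : D.pos 2 ≤ nv) (hnvL : nv < #(triBdryDarts D.verts))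
    (hC : IsTriLoop (D.chordLoop Q nv (nu + #(triBdryDarts D.verts) - nv)))
    (hπw : faceLabel (cycDarts (D.chordLoop Q nv (nu + #(triBdryDarts D.verts) - nv))) w =
      leftLabel (D.chordLoop Q nv (nu + #(triBdryDarts D.verts) - nv)))
    (hnotw : ∀ Q' : List (Site 2), (hne : Q' ≠ []) → Q'.Nodup → List.IsChain triGraph.Adj Q' →
      (∀ s ∈ Q', s ∈ D.verts ∧ s ∈ ω) → Q'.head hne ∈ D.arc 1 → Q'.getLast hne ∈ D.arc 2 →
      ¬ Separates D.verts {e : Sym2 (Site 2) | ∃ d ∈ pathDarts Q', e = s(d.1, d.2)} w (D.stretch 0))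
    {B P₀ : List (Site 2)} (hB : B ≠ [])
    (hE : ∀ e : Sym2 (Site 2), (∃ d ∈ pathDarts Q, e = s(d.1, d.2)) ↔
      (∃ d ∈ pathDarts B, e = s(d.1, d.2)) ∨ (∃ d ∈ pathDarts P₀, e = s(d.1, d.2)))
    (hP₀ne : P₀ ≠ []) (hP₀nd : P₀.Nodup) (hP₀ch : List.IsChain triGraph.Adj P₀)
    (hP₀G : ∀ s ∈ P₀, s ∈ D.verts ∧ s ∈ ω) (hP₀head : P₀.head hP₀ne ∈ D.arc 1) (hP₀last : P₀.getLast hP₀ne ∈ D.arc 2)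
    {nvPl lenPl : ℕ} (hPl : IsTriLoop (D.chordLoop B nvPl lenPl))
    (htarget : ∀ F : HexVertex, (∃ d ∈ D.stretch 0, d.1 ∈ hexFaceVertices F ∧ d.2 ∈ hexFaceVertices F) →
      faceLabel (cycDarts (D.chordLoop B nvPl lenPl)) F = leftLabel (D.chordLoop B nvPl lenPl) + 1)
    {a b : Site 2} (hab : (a, b) ∈ pathDarts B) (hw : leftFace a b = w) : False := by
  set L := #(triBdryDarts D.verts) with hL
  set C := D.chordLoop Q nv (nu + L - nv) with hCdef
  set Pl := D.chordLoop B nvPl lenPl with hPldef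
  have hlen : nv + (nu + L - nv) = nu + L := by omega
  have hns := hnotw P₀ hP₀ne hP₀nd hP₀ch hP₀G hP₀head hP₀last
  unfold Separates at hns
  push Not at hns
  obtain ⟨F, hF, hreach⟩ := hns
  -- G-bonds of the two loops
  have hGbond : ∀ {X : List (Site 2)} (hX : X ≠ []) {nv' len' : ℕ} {x y : Site 2}, x ∈ D.verts → y ∈ D.verts →
      ((∃ d ∈ cycDarts (D.chordLoop X nv' len'), s(x, y) = s(d.1, d.2)) ↔ ∃ d ∈ pathDarts X, s(x, y) = s(d.1, d.2)) := by
    intro X hX nv' len' x y hx hy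
    constructor
    · rintro ⟨d, hd, he⟩
      have h1 : d.1 ∈ s(x, y) := by rw [he]; exact Sym2.mem_mk_left _ _
      have h2 : d.2 ∈ s(x, y) := by rw [he]; exact Sym2.mem_mk_right _ _
      have h1G : d.1 ∈ D.verts := by rcases Sym2.mem_iff.1 h1 with h | h <;> (rw [h]; assumption)
      have h2G : d.2 ∈ D.verts := by rcases Sym2.mem_iff.1 h2 with h | h <;> (rw [h]; assumption)
      exact ⟨d, D.mem_pathDarts_of_mem_cycDarts_chordLoop hX hd h1G h2G, he⟩
    · rintro ⟨d, hd, he⟩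
      exact ⟨d, D.mem_cycDarts_chordLoop_of_mem_pathDarts (nv := nv') hX len' hd, he⟩
  have hpar : ∀ x y, x ∈ D.verts → y ∈ D.verts →
      s(x, y) ∉ {e : Sym2 (Site 2) | ∃ d ∈ pathDarts P₀, e = s(d.1, d.2)} →
      lbond (cycDarts C) x y = lbond (cycDarts Pl) x y := by
    intro x y hx hy hnot
    have hnot' : ¬ ∃ d ∈ pathDarts P₀, s(x, y) = s(d.1, d.2) := hnot
    rw [hC.lbond_eq_ite, hPl.lbond_eq_ite, if_congr (hGbond hQne hx hy) rfl rfl, if_congr (hGbond hB hx hy) rfl rfl,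
      if_congr (hE _) rfl rfl]
    simp only [hnot', or_false]
  have hsum := faceLabel_add_eq_of_reflTransGen_dualStep hC.adj hPl.adj hpar hreach
  have hπF : faceLabel (cycDarts C) F = leftLabel C :=
    D.faceLabel_eq_leftLabel_of_stretch_zero hQne hQG hnu1 hnu2 hnv2 hnvL hlen hC hF
  have hlF := htarget F hF
  have hlw : faceLabel (cycDarts Pl) w = leftLabel Pl := by
    rw [← hw]; exact hPl.faceLabel_leftFace (D.mem_cycDarts_chordLoop_of_mem_pathDarts (nv := nvPl) hB lenPl hab)
  rw [hπw, hπF, hlF, hlw] at hsum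
  have key : ∀ a b : ZMod 2, a + b ≠ a + (b + 1) := by decide
  exact key _ _ hsum

omit D in
/-- A list through `… a, b …` has the dart `(a, b)`. [folklore] -/
theorem mem_pathDarts_append_cons_cons (L₁ rest : List (Site 2)) (a b : Site 2) :
    (a, b) ∈ pathDarts (L₁ ++ a :: b :: rest) := by
  by_cases h : L₁ = []
  · subst h; simp
  · rw [pathDarts_append h (List.cons_ne_nil _ _)]
    exact List.mem_append_right _ (List.mem_cons_of_mem _ (by simp))

/-- **Degenerate contact with `A₁`**: the path's final part `x₂ ⋯ v` passes through a site `c`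
which is the tail of a boundary dart of `A₁` at a position `n'` with `n' + 1 < nᵤ`. Then the
final part from `c` is an admissible path and the initial part up to `c` a bump, closed by the
heads over `[n', nᵤ]` to a loop with all faces of `A₀` on its right
(`faceLabel_eq_leftLabel_add_one_of_mem_Ico`): `false_of_bump`. [folklore] -/
theorem false_of_contact_one {Q L₁ L₂ : List (Site 2)} {a b : Site 2} (hQeq : Q = L₁ ++ a :: b :: L₂) (hQnd : Q.Nodup)
    (hQch : List.IsChain triGraph.Adj Q) (hQG : ∀ s ∈ Q, s ∈ D.verts) (hQω : ∀ s ∈ Q, s ∈ ω)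
    {nu nv : ℕ} (hnu1 : D.pos 1 ≤ nu) (hnu2 : nu < D.pos 2) (hnv2 : D.pos 2 ≤ nv) (hnvL : nv < #(triBdryDarts D.verts))
    (hQhead : Q.head (by rw [hQeq]; simp) = (triBdryIter D.verts D.base nu).1)
    (hQlast : Q.getLast (by rw [hQeq]; simp) = (triBdryIter D.verts D.base nv).1)
    (hC : IsTriLoop (D.chordLoop Q nv (nu + #(triBdryDarts D.verts) - nv)))
    (hπw : faceLabel (cycDarts (D.chordLoop Q nv (nu + #(triBdryDarts D.verts) - nv))) w =
      leftLabel (D.chordLoop Q nv (nu + #(triBdryDarts D.verts) - nv)))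
    (hnotw : ∀ Q' : List (Site 2), (hne : Q' ≠ []) → Q'.Nodup → List.IsChain triGraph.Adj Q' →
      (∀ s ∈ Q', s ∈ D.verts ∧ s ∈ ω) → Q'.head hne ∈ D.arc 1 → Q'.getLast hne ∈ D.arc 2 →
      ¬ Separates D.verts {e : Sym2 (Site 2) | ∃ d ∈ pathDarts Q', e = s(d.1, d.2)} w (D.stretch 0))
    (hw : leftFace a b = w) {c : Site 2} (hcQ : c ∈ b :: L₂) {n' : ℕ} (hn'1 : D.pos 1 ≤ n') (hn'u : n' + 1 < nu)
    (hct : (triBdryIter D.verts D.base n').1 = c) : False := by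
  set L := #(triBdryDarts D.verts) with hL
  have hQne : Q ≠ [] := by rw [hQeq]; simp
  have h12 := D.pos_lt_pos₃ (show (1 : Fin 3) < 2 by decide)
  have hL3 := D.three_le_card 0
  obtain ⟨T₂, T', hsplit⟩ := List.append_of_mem hcQ
  -- `Q = (L₁ ++ [a] ++ T₂) ++ [c] ++ T'`
  set B := L₁ ++ [a] ++ T₂ ++ [c] with hBdef
  have hQ3 : Q = (L₁ ++ [a] ++ T₂) ++ [c] ++ T' := by rw [hQeq, show a :: b :: L₂ = [a] ++ (b :: L₂) from rfl, hsplit]; simp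
  have hQBP : Q = (L₁ ++ [a] ++ T₂) ++ (c :: T') := by rw [hQ3]; simp
  have hBne : B ≠ [] := by simp [hBdef]
  have hP₀ne : (c :: T') ≠ [] := List.cons_ne_nil _ _
  -- bonds of `Q` = bonds of `B` ∪ bonds of `(c :: T')`
  have hE : ∀ e : Sym2 (Site 2), (∃ d ∈ pathDarts Q, e = s(d.1, d.2)) ↔
      (∃ d ∈ pathDarts B, e = s(d.1, d.2)) ∨ (∃ d ∈ pathDarts (c :: T'), e = s(d.1, d.2)) := by
    intro e
    rw [hQ3, exists_mem_pathDarts_three_iff (List.cons_ne_nil c [])]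
    simp only [List.head_cons, List.getLast_singleton, pathDarts_singleton, List.not_mem_nil, false_and,
      exists_false, false_or]
    rfl
  -- `(c :: T')` is admissible
  have hP₀nd : (c :: T').Nodup := (List.nodup_append.1 (hQBP ▸ hQnd)).2.1
  have hP₀ch : List.IsChain triGraph.Adj (c :: T') := (hQBP ▸ hQch).right_of_append
  have hP₀G : ∀ s ∈ (c :: T'), s ∈ D.verts ∧ s ∈ ω := fun s hs =>
    ⟨hQG s (by rw [hQBP]; exact List.mem_append_right _ hs), hQω s (by rw [hQBP]; exact List.mem_append_right _ hs)⟩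
  have hP₀head : (c :: T').head hP₀ne ∈ D.arc 1 := by
    show c ∈ D.arc 1
    rw [← hct]
    have := D.iter_fst_mem_arc₃ n'
    have hs : D.stretchIdx₃ n' = 1 := by
      unfold stretchIdx₃; rw [Nat.mod_eq_of_lt (by omega), if_neg (by omega), if_pos (by omega)]
    rwa [hs] at this
  have hP₀last : (c :: T').getLast hP₀ne ∈ D.arc 2 := by
    have e : (c :: T').getLast hP₀ne = Q.getLast hQne := by
      have key : ∀ (l : List (Site 2)) (hl : l ≠ []), l = (L₁ ++ [a] ++ T₂) ++ (c :: T') → (c :: T').getLast hP₀ne = l.getLast hl := by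
        intro l hl h; subst h; exact (List.getLast_append_of_right_ne_nil _ _ hP₀ne).symm
      exact key Q hQne hQBP
    rw [e, hQlast]
    have := D.iter_fst_mem_arc₃ nv
    have hs : D.stretchIdx₃ nv = 2 := by
      unfold stretchIdx₃; rw [Nat.mod_eq_of_lt hnvL, if_neg (by omega), if_neg (by omega)]
    rwa [hs] at this
  -- the bump `B` and its chord loop
  have hBnd : B.Nodup := by
    have : Q = B ++ T' := by rw [hQ3]
    exact (List.nodup_append.1 (this ▸ hQnd)).1
  have hBch : List.IsChain triGraph.Adj B := by
    have : Q = B ++ T' := by rw [hQ3]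
    exact (this ▸ hQch).left_of_append
  have hBG : ∀ s ∈ B, s ∈ D.verts := fun s hs => hQG s (by rw [hQ3]; exact List.mem_append_left _ hs)
  have hBlast : B.getLast hBne = (triBdryIter D.verts D.base (n' + L)).1 := by
    rw [D.iter_add_card, hct]; simp [hBdef]
  have hBhead : B.head hBne = (triBdryIter D.verts D.base (n' + L + (nu - n'))).1 := by
    rw [show n' + L + (nu - n') = nu + L by omega, D.iter_add_card, ← hQhead]
    have key : ∀ (l : List (Site 2)) (hl : l ≠ []), l = B ++ T' → B.head hBne = l.head hl := by
      intro l hl h; subst h; exact (List.head_append_of_ne_nil hBne).symm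
    exact key Q hQne (by rw [hQ3])
  have hB2 : 2 ≤ B.length := by simp [hBdef]; omega
  have hHnd : (D.headsList (n' + L) (nu - n')).Nodup :=
    D.headsList_nodup (m := n' + L) (N := nu - n') (c := D.pos 2 + (L - 1)) (by omega) (by omega)
      (D.bdryHead_markPos_pred_ne 2) le_rfl
  have hPl : IsTriLoop (D.chordLoop B (n' + L) (nu - n')) :=
    D.isTriLoop_chordLoop hBne hBnd hBch hBG hB2 hBlast hBhead hHnd
  -- every face of `A₀` is right of it
  have htarget : ∀ F : HexVertex, (∃ d ∈ D.stretch 0, d.1 ∈ hexFaceVertices F ∧ d.2 ∈ hexFaceVertices F) →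
      faceLabel (cycDarts (D.chordLoop B (n' + L) (nu - n'))) F = leftLabel (D.chordLoop B (n' + L) (nu - n')) + 1 := by
    intro F hF
    obtain ⟨p, hp, hFp⟩ := D.exists_eq_leftFace_of_stretch_zero hF
    have hγ := fun q (h1 : nu ≤ q) (h2 : q + 1 ≤ n' + L) =>
      D.faceLabel_eq_leftLabel_add_one_of_mem_Ico hBne hBG (nu := nu) (nv := n' + L) (len := nu - n')
        (by omega) (by omega) (by omega) hBlast hBhead hPl h1 h2
    have hnuL : nu ≤ L - 1 := by have := D.pos_lt 2; omega
    rcases hFp with rfl | rfl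
    · exact hγ (p + L) (by omega) (by omega)
    · exact hγ (p + L - 1) (by omega) (by omega)
  -- the dart `(a, b)` of the bump
  have hab : (a, b) ∈ pathDarts B := by
    have : B = L₁ ++ a :: b :: (T₂ ++ [c]).tail := by
      rw [hBdef]
      cases T₂ with
      | nil =>
        have : b = c := by simpa using (congrArg List.head? hsplit)
        simp [this]
      | cons t ts =>
        have : t = b := by simpa using (congrArg List.head? hsplit).symm
        simp [this]
    rw [this]
    exact mem_pathDarts_append_cons_cons _ _ _ _
  exact D.false_of_bump hQne hQG hnu1 hnu2 hnv2 hnvL hC hπw hnotw hBne hE hP₀ne hP₀nd hP₀ch hP₀G hP₀head hP₀last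
    hPl htarget hab hw

/-- **Degenerate contact with `A₂`**: the path's initial part `u ⋯ x₁` passes through a site
`c` which is the tail of a boundary dart of `A₂` at a position `n'' > nᵥ`. Then the initial
part up to `c` is an admissible path and the final part from `c` a bump, closed by the heads
over `[nᵥ, n'']` to a loop with all faces of `A₀` on its right: `false_of_bump`. [folklore] -/
theorem false_of_contact_two {Q L₁ L₂ : List (Site 2)} {a b : Site 2} (hQeq : Q = L₁ ++ a :: b :: L₂) (hQnd : Q.Nodup)
    (hQch : List.IsChain triGraph.Adj Q) (hQG : ∀ s ∈ Q, s ∈ D.verts) (hQω : ∀ s ∈ Q, s ∈ ω)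
    {nu nv : ℕ} (hnu1 : D.pos 1 ≤ nu) (hnu2 : nu < D.pos 2) (hnv2 : D.pos 2 ≤ nv) (hnvL : nv < #(triBdryDarts D.verts))
    (hQhead : Q.head (by rw [hQeq]; simp) = (triBdryIter D.verts D.base nu).1)
    (hQlast : Q.getLast (by rw [hQeq]; simp) = (triBdryIter D.verts D.base nv).1)
    (hC : IsTriLoop (D.chordLoop Q nv (nu + #(triBdryDarts D.verts) - nv)))
    (hπw : faceLabel (cycDarts (D.chordLoop Q nv (nu + #(triBdryDarts D.verts) - nv))) w =
      leftLabel (D.chordLoop Q nv (nu + #(triBdryDarts D.verts) - nv)))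
    (hnotw : ∀ Q' : List (Site 2), (hne : Q' ≠ []) → Q'.Nodup → List.IsChain triGraph.Adj Q' →
      (∀ s ∈ Q', s ∈ D.verts ∧ s ∈ ω) → Q'.head hne ∈ D.arc 1 → Q'.getLast hne ∈ D.arc 2 →
      ¬ Separates D.verts {e : Sym2 (Site 2) | ∃ d ∈ pathDarts Q', e = s(d.1, d.2)} w (D.stretch 0))
    (hw : leftFace a b = w) {c : Site 2} (hcQ : c ∈ L₁ ++ [a]) {n'' : ℕ} (hn''v : nv < n'')
    (hn''L : n'' < #(triBdryDarts D.verts)) (hct : (triBdryIter D.verts D.base n'').1 = c) : False := by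
  set L := #(triBdryDarts D.verts) with hL
  have hQne : Q ≠ [] := by rw [hQeq]; simp
  have h12 := D.pos_lt_pos₃ (show (1 : Fin 3) < 2 by decide)
  have h01 := D.pos_lt_pos₃ (show (0 : Fin 3) < 1 by decide)
  have hL3 := D.three_le_card 0
  obtain ⟨A', A₂, hsplit⟩ := List.append_of_mem hcQ
  -- `Q = A' ++ [c] ++ (A₂ ++ b :: L₂)`
  set B := c :: (A₂ ++ b :: L₂) with hBdef
  have hQ3 : Q = A' ++ [c] ++ (A₂ ++ b :: L₂) := by
    rw [hQeq, show L₁ ++ a :: b :: L₂ = (L₁ ++ [a]) ++ (b :: L₂) by simp, hsplit]; simp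
  have hQPB : Q = A' ++ B := by rw [hQ3]; simp [hBdef]
  have hBne : B ≠ [] := List.cons_ne_nil _ _
  have hP₀ne : A' ++ [c] ≠ [] := by simp
  have hE : ∀ e : Sym2 (Site 2), (∃ d ∈ pathDarts Q, e = s(d.1, d.2)) ↔
      (∃ d ∈ pathDarts B, e = s(d.1, d.2)) ∨ (∃ d ∈ pathDarts (A' ++ [c]), e = s(d.1, d.2)) := by
    intro e
    rw [hQ3, exists_mem_pathDarts_three_iff (List.cons_ne_nil c [])]
    simp only [List.head_cons, List.getLast_singleton, pathDarts_singleton, List.not_mem_nil, false_and,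
      exists_false, false_or]
    rw [or_comm]
  -- `A' ++ [c]` is admissible
  have hP₀nd : (A' ++ [c]).Nodup := by
    have : Q = (A' ++ [c]) ++ (A₂ ++ b :: L₂) := by rw [hQ3]
    exact (List.nodup_append.1 (this ▸ hQnd)).1
  have hP₀ch : List.IsChain triGraph.Adj (A' ++ [c]) := by
    have : Q = (A' ++ [c]) ++ (A₂ ++ b :: L₂) := by rw [hQ3]
    exact (this ▸ hQch).left_of_append
  have hP₀G : ∀ s ∈ A' ++ [c], s ∈ D.verts ∧ s ∈ ω := fun s hs =>
    ⟨hQG s (by rw [hQ3]; exact List.mem_append_left _ hs), hQω s (by rw [hQ3]; exact List.mem_append_left _ hs)⟩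
  have hP₀head : (A' ++ [c]).head hP₀ne ∈ D.arc 1 := by
    have e : (A' ++ [c]).head hP₀ne = Q.head hQne := by
      have key : ∀ (l : List (Site 2)) (hl : l ≠ []), l = (A' ++ [c]) ++ (A₂ ++ b :: L₂) →
          (A' ++ [c]).head hP₀ne = l.head hl := by
        intro l hl h; subst h; exact (List.head_append_of_ne_nil hP₀ne).symm
      exact key Q hQne (by rw [hQ3])
    rw [e, hQhead]
    have := D.iter_fst_mem_arc₃ nu
    have hs : D.stretchIdx₃ nu = 1 := by
      unfold stretchIdx₃; rw [Nat.mod_eq_of_lt (by omega), if_neg (by omega), if_pos hnu2]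
    rwa [hs] at this
  have hP₀last : (A' ++ [c]).getLast hP₀ne ∈ D.arc 2 := by
    rw [List.getLast_append_of_right_ne_nil _ _ (List.cons_ne_nil _ _), List.getLast_singleton, ← hct]
    have := D.iter_fst_mem_arc₃ n''
    have hs : D.stretchIdx₃ n'' = 2 := by
      unfold stretchIdx₃; rw [Nat.mod_eq_of_lt hn''L, if_neg (by omega), if_neg (by omega)]
    rwa [hs] at this
  -- the bump `B` and its chord loop, closed by the heads over `[nᵥ + L, n'' + L]`
  have hBnd : B.Nodup := (List.nodup_append.1 (hQPB ▸ hQnd)).2.1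
  have hBch : List.IsChain triGraph.Adj B := (hQPB ▸ hQch).right_of_append
  have hBG : ∀ s ∈ B, s ∈ D.verts := fun s hs => hQG s (by rw [hQPB]; exact List.mem_append_right _ hs)
  have hBlast : B.getLast hBne = (triBdryIter D.verts D.base (nv + L)).1 := by
    rw [D.iter_add_card, ← hQlast]
    have key : ∀ (l : List (Site 2)) (hl : l ≠ []), l = A' ++ B → B.getLast hBne = l.getLast hl := by
      intro l hl h; subst h; exact (List.getLast_append_of_right_ne_nil _ _ hBne).symm
    exact key Q hQne hQPB
  have hBhead : B.head hBne = (triBdryIter D.verts D.base (nv + L + (n'' - nv))).1 := by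
    rw [show nv + L + (n'' - nv) = n'' + L by omega, D.iter_add_card, hct]; rfl
  have hB2 : 2 ≤ B.length := by simp [hBdef]; omega
  have hHnd : (D.headsList (nv + L) (n'' - nv)).Nodup := by
    refine D.headsList_nodup (m := nv + L) (N := n'' - nv) (c := (L - 1) + L) (by omega) (by omega) ?_ le_rfl
    have := D.bdryHead_markPos_pred_ne 0
    have hz : D.pos 0 = 0 := D.pos_zero (by decide)
    rw [hz, zero_add] at this
    rwa [show L - 1 + L + 1 = (L - 1 + 1) + L by omega, D.bdryHead_add_card, D.bdryHead_add_card]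
  have hPl : IsTriLoop (D.chordLoop B (nv + L) (n'' - nv)) :=
    D.isTriLoop_chordLoop hBne hBnd hBch hBG hB2 hBlast hBhead hHnd
  have htarget : ∀ F : HexVertex, (∃ d ∈ D.stretch 0, d.1 ∈ hexFaceVertices F ∧ d.2 ∈ hexFaceVertices F) →
      faceLabel (cycDarts (D.chordLoop B (nv + L) (n'' - nv))) F = leftLabel (D.chordLoop B (nv + L) (n'' - nv)) + 1 := by
    intro F hF
    obtain ⟨p, hp, hFp⟩ := D.exists_eq_leftFace_of_stretch_zero hF
    have hγ := fun q (h1 : n'' ≤ q) (h2 : q + 1 ≤ nv + L) =>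
      D.faceLabel_eq_leftLabel_add_one_of_mem_Ico hBne hBG (nu := n'') (nv := nv + L) (len := n'' - nv)
        (by omega) (by omega) (by omega) hBlast hBhead hPl h1 h2
    have hp1 : p + 1 ≤ nv := by omega
    rcases hFp with rfl | rfl
    · exact hγ (p + L) (by omega) (by omega)
    · exact hγ (p + L - 1) (by omega) (by omega)
  -- the dart `(a, b)` of the bump: `c :: A₂` ends with `a`
  have hab : (a, b) ∈ pathDarts B := by
    have hlastc : (c :: A₂).getLast (List.cons_ne_nil _ _) = a := by
      have : (L₁ ++ [a]).getLast (by simp) = (A' ++ c :: A₂).getLast (by simp) := by simp only [hsplit]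
      rw [List.getLast_append_of_right_ne_nil _ _ (List.cons_ne_nil _ _)] at this
      simpa using this.symm
    have hca : c :: A₂ = (c :: A₂).dropLast ++ [a] := by
      rw [← hlastc]; exact (List.dropLast_append_getLast (List.cons_ne_nil _ _)).symm
    have : B = (c :: A₂).dropLast ++ a :: b :: L₂ := by
      rw [hBdef, show c :: (A₂ ++ b :: L₂) = (c :: A₂) ++ (b :: L₂) by simp]
      conv_lhs => rw [hca]
      simp
    rw [this]
    exact mem_pathDarts_append_cons_cons _ _ _ _
  exact D.false_of_bump hQne hQG hnu1 hnu2 hnv2 hnvL hC hπw hnotw hBne hE hP₀ne hP₀nd hP₀ch hP₀G hP₀head hP₀last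
    hPl htarget hab hw

end Bump

/-! ### The cycle case is impossible -/

section CycleFalse

variable (D : TriMarkedDomain 3) {ω : Set (Site 2)} {w : HexVertex} {orb : ℕ → HexVertex} {N : ℕ}
  (horb : ∀ k < N, D.ifaceNext₃ ω (orb k) = some (orb (k + 1)))
  (hleft : ∀ k < N, D.leftCell₃ ω (orb k) ∈ D.verts) (hw0 : orb 0 = w)

include horb hleft hw0 in
/-- **The interface from `w` does not close up** ("Suppose next that the component of `I`
containing `f` is a cycle … Our aim is to deduce a contradiction", pp. 178–179). With the right
cells `ρ₀ = x₂` on the final part of the path and `ρ_{N-1} = x₁` on the initial part: let `r`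
be the last index whose right cell is on the final part or is a contact with `A₂`, and `s ≥ r`
the first index after it whose right cell is on the initial part or is a contact with `A₁`. The
right cells strictly between are sites of `G` (a block of outer ones is entered and left across
darts of the same black stretch, `cyc_block_exit_two`, which would make one of its ends an
anchor) off the path; `r < s` is the main case (`cyc_main_false`, the endpoints differ by
`false_of_two_sided`), `r = s` the degenerate contacts (`false_of_contact_one/two`,
`false_of_two_sided`). [cite: BollobasRiordan2006, Ch. 7 Claim 10 pp. 178–179] -/
theorem cyc_false {Q L₁ L₂ : List (Site 2)} {a b : Site 2} (hQeq : Q = L₁ ++ a :: b :: L₂) (hQnd : Q.Nodup)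
    (hQch : List.IsChain triGraph.Adj Q) (hQG : ∀ s ∈ Q, s ∈ D.verts) (hQω : ∀ s ∈ Q, s ∈ ω)
    {nu nv : ℕ} (hnu1 : D.pos 1 ≤ nu) (hnu2 : nu < D.pos 2) (hnv2 : D.pos 2 ≤ nv) (hnvL : nv < #(triBdryDarts D.verts))
    (hQhead : Q.head (by rw [hQeq]; simp) = (triBdryIter D.verts D.base nu).1)
    (hQlast : Q.getLast (by rw [hQeq]; simp) = (triBdryIter D.verts D.base nv).1)
    (hC : IsTriLoop (D.chordLoop Q nv (nu + #(triBdryDarts D.verts) - nv)))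
    (hπw : faceLabel (cycDarts (D.chordLoop Q nv (nu + #(triBdryDarts D.verts) - nv))) w =
      leftLabel (D.chordLoop Q nv (nu + #(triBdryDarts D.verts) - nv)))
    (hnotw : ∀ Q' : List (Site 2), (hne : Q' ≠ []) → Q'.Nodup → List.IsChain triGraph.Adj Q' →
      (∀ s ∈ Q', s ∈ D.verts ∧ s ∈ ω) → Q'.head hne ∈ D.arc 1 → Q'.getLast hne ∈ D.arc 2 →
      ¬ Separates D.verts {e : Sym2 (Site 2) | ∃ d ∈ pathDarts Q', e = s(d.1, d.2)} w (D.stretch 0))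
    (hw : leftFace a b = w) (hN : 0 < N) (hρ0 : D.rightCell₃ ω (orb 0) = b) (hρN : D.rightCell₃ ω (orb (N - 1)) = a) :
    False := by
  classical
  set L := #(triBdryDarts D.verts) with hL
  set ρ : ℕ → Site 2 := fun k => D.rightCell₃ ω (orb k) with hρ
  have hQne : Q ≠ [] := by rw [hQeq]; simp
  have hQeq' : Q = (L₁ ++ [a]) ++ (b :: L₂) := by rw [hQeq]; simp
  have hlt : nu < nv := by omega
  have hv : (triBdryIter D.verts D.base nv).1 ∈ ω := by rw [← hQlast]; exact hQω _ (List.getLast_mem hQne)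
  have hu : (triBdryIter D.verts D.base nu).1 ∈ Q := by rw [← hQhead]; exact List.head_mem hQne
  have hdisj : ∀ x, x ∈ L₁ ++ [a] → x ∈ b :: L₂ → False := fun x h1 h2 =>
    (List.nodup_append.1 (hQeq' ▸ hQnd)).2.2 x h1 x h2 rfl
  -- positions of black boundary darts, from the stretch index
  have hstretch1 : ∀ {d}, d ∈ triBdryDarts D.verts → D.stretchIdx₃ (D.dpos d) = 1 →
      D.pos 1 ≤ D.dpos d ∧ D.dpos d < D.pos 2 := by
    intro d hd hs
    have hlt' := D.dpos_lt hd
    unfold stretchIdx₃ at hs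
    rw [Nat.mod_eq_of_lt hlt'] at hs
    by_cases ha : D.dpos d < D.pos 1
    · rw [if_pos ha] at hs; exact absurd hs (by decide)
    · rw [if_neg ha] at hs
      by_cases hb : D.dpos d < D.pos 2
      · exact ⟨by omega, hb⟩
      · rw [if_neg hb] at hs; exact absurd hs (by decide)
  have hstretch2 : ∀ {d}, d ∈ triBdryDarts D.verts → D.stretchIdx₃ (D.dpos d) = 2 →
      D.pos 2 ≤ D.dpos d ∧ D.dpos d < L := by
    intro d hd hs
    have hlt' := D.dpos_lt hd
    refine ⟨?_, hlt'⟩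
    unfold stretchIdx₃ at hs
    rw [Nat.mod_eq_of_lt hlt'] at hs
    by_contra hb
    push Not at hb
    by_cases ha : D.dpos d < D.pos 1
    · rw [if_pos ha] at hs; exact absurd hs (by decide)
    · rw [if_neg ha, if_pos hb] at hs; exact absurd hs (by decide)
  have hne0 : ∀ {i : Fin 3}, i ≠ 0 → i = 1 ∨ i = 2 := by decide
  -- anchors
  let A2 : ℕ → Prop := fun k => ρ k ∈ b :: L₂ ∨
    (ρ k ∈ D.verts ∧ 1 ≤ k ∧ ρ (k - 1) ∉ D.verts ∧ D.stretchIdx₃ (D.dpos (ρ k, ρ (k - 1))) = 2)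
  let A1 : ℕ → Prop := fun k => ρ k ∈ L₁ ++ [a] ∨
    (ρ k ∈ D.verts ∧ k + 1 < N ∧ ρ (k + 1) ∉ D.verts ∧ D.stretchIdx₃ (D.dpos (ρ k, ρ (k + 1))) = 1)
  have hA2G : ∀ k, A2 k → ρ k ∈ D.verts := fun k h => h.elim (fun h => hQG _ (by rw [hQeq']; exact List.mem_append_right _ h)) (fun h => h.1)
  have hA1G : ∀ k, A1 k → ρ k ∈ D.verts := fun k h => h.elim (fun h => hQG _ (by rw [hQeq']; exact List.mem_append_left _ h)) (fun h => h.1)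
  set r := Nat.findGreatest A2 (N - 1) with hrdef
  have hA2_0 : A2 0 := Or.inl (by show ρ 0 ∈ b :: L₂; rw [show ρ 0 = b from hρ0]; simp)
  have hA2r : A2 r := Nat.findGreatest_spec (P := A2) (Nat.zero_le _) hA2_0
  have hrN : r ≤ N - 1 := Nat.findGreatest_le _
  have hrmax : ∀ k, r < k → k ≤ N - 1 → ¬ A2 k := fun k h1 h2 => Nat.findGreatest_is_greatest h1 h2
  have hA1_N : A1 (N - 1) := Or.inl (by show ρ (N - 1) ∈ L₁ ++ [a]; rw [show ρ (N - 1) = a from hρN]; simp)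
  have hex1 : ∃ k, r ≤ k ∧ k ≤ N - 1 ∧ A1 k := ⟨N - 1, hrN, le_rfl, hA1_N⟩
  set s := Nat.find hex1 with hsdef
  obtain ⟨hrs, hsN, hA1s⟩ := Nat.find_spec hex1
  have hsmin : ∀ k, r ≤ k → k < s → ¬ A1 k := fun k h1 h2 h3 =>
    Nat.find_min hex1 (show k < Nat.find hex1 from h2) ⟨h1, by omega, h3⟩
  have hρrG : ρ r ∈ D.verts := hA2G r hA2r
  have hρsG : ρ s ∈ D.verts := hA1G s hA1s
  have hsN' : s < N := by omega
  -- contact darts: membership and positions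
  have hc1 : ∀ k, k + 1 < N → ρ k ∈ D.verts → ρ (k + 1) ∉ D.verts →
      D.stretchIdx₃ (D.dpos (ρ k, ρ (k + 1))) = 1 →
      (ρ k, ρ (k + 1)) ∈ triBdryDarts D.verts ∧ D.pos 1 ≤ D.dpos (ρ k, ρ (k + 1)) ∧
        D.dpos (ρ k, ρ (k + 1)) + 1 < nu ∧ (triBdryIter D.verts D.base (D.dpos (ρ k, ρ (k + 1)))).1 = ρ k := by
    intro k hk hin hout hst
    have hd := (D.cyc_entry_dart horb hleft hk hin hout).1
    refine ⟨hd, (hstretch1 hd hst).1, ?_, by rw [D.iter_dpos hd]⟩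
    exact D.cyc_one_contact_pos horb hleft hw0 hQne hQG hQω hlt hnvL hQhead hQlast hC hπw hnv2 hv hk hin hout hst
  have hc2 : ∀ k, 1 ≤ k → k < N → ρ k ∈ D.verts → ρ (k - 1) ∉ D.verts →
      D.stretchIdx₃ (D.dpos (ρ k, ρ (k - 1))) = 2 →
      (ρ k, ρ (k - 1)) ∈ triBdryDarts D.verts ∧ nv < D.dpos (ρ k, ρ (k - 1)) ∧
        D.dpos (ρ k, ρ (k - 1)) < L ∧ (triBdryIter D.verts D.base (D.dpos (ρ k, ρ (k - 1)))).1 = ρ k := by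
    intro k hk1 hk hin hout hst
    have hk' : k - 1 + 1 < N := by omega
    have hout' : ρ (k - 1) ∉ D.verts := hout
    have hin' : D.rightCell₃ ω (orb (k - 1 + 1)) ∈ D.verts := by rw [show k - 1 + 1 = k by omega]; exact hin
    have hsucc := (D.cyc_succ_dart horb hleft hk' hout').2 hin'
    rw [show k - 1 + 1 = k by omega] at hsucc
    have hd : (ρ k, ρ (k - 1)) ∈ triBdryDarts D.verts := by
      show (D.rightCell₃ ω (orb k), D.rightCell₃ ω (orb (k - 1))) ∈ _
      rw [hsucc]; exact triBdrySucc_mem (D.cyc_dart_mem_of_not_mem horb hleft (by omega) hout').1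
    have hpos := D.cyc_two_contact_pos horb hleft hw0 hQne hQG hQω hlt hnvL hQhead hQlast hC hπw hnu2 hk' hout' hin'
      (by rw [show k - 1 + 1 = k by omega]; exact hst)
    rw [show k - 1 + 1 = k by omega] at hpos
    exact ⟨hd, hpos, D.dpos_lt hd, by rw [D.iter_dpos hd]⟩
  -- a site off the path cannot be both a contact with `A₁` and a contact with `A₂`
  have htwo : ∀ k₁ k₂, ρ k₁ = ρ k₂ → ρ k₁ ∉ Q →
      (1 ≤ k₁ ∧ k₁ < N ∧ ρ k₁ ∈ D.verts ∧ ρ (k₁ - 1) ∉ D.verts ∧ D.stretchIdx₃ (D.dpos (ρ k₁, ρ (k₁ - 1))) = 2) →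
      (k₂ + 1 < N ∧ ρ k₂ ∈ D.verts ∧ ρ (k₂ + 1) ∉ D.verts ∧ D.stretchIdx₃ (D.dpos (ρ k₂, ρ (k₂ + 1))) = 1) → False := by
    rintro k₁ k₂ heq hnQ ⟨h11, h12, h13, h14, h15⟩ ⟨h21, h22, h23, h24⟩
    obtain ⟨-, hn'1, hn'u, ht'⟩ := hc1 k₂ h21 h22 h23 h24
    obtain ⟨-, hn''v, hn''L, ht''⟩ := hc2 k₁ h11 h12 h13 h14 h15
    refine D.false_of_two_sided hn'1 (by omega) (show nu < D.dpos (ρ k₁, ρ (k₁ - 1)) by omega) hn''L ht'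
      (by rw [ht'', heq]) ?_
    intro e
    exact hnQ (by rw [heq, ← e]; exact hu)
  -- (m1): the right cells strictly between are in `G`
  have hm1 : ∀ k, r < k → k < s → ρ k ∈ D.verts := by
    intro k hk1 hk2
    by_contra hout
    -- the block of outer right cells through `k`: from `m₁` …
    have hexm : ∃ m, ∀ i, m ≤ i → i ≤ k → ρ i ∉ D.verts :=
      ⟨k, fun i h1 h2 => by rw [show i = k by omega]; exact hout⟩
    obtain ⟨hm₁k, hm₁⟩ : Nat.find hexm ≤ k ∧ ∀ i, Nat.find hexm ≤ i → i ≤ k → ρ i ∉ D.verts :=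
      ⟨Nat.find_min' hexm (fun i h1 h2 => by rw [show i = k by omega]; exact hout), Nat.find_spec hexm⟩
    set m₁ := Nat.find hexm with hm₁def
    have hm₁r : r < m₁ := by
      by_contra hle; push Not at hle
      exact hm₁ r hle (by omega) hρrG
    have hin₁ : ρ (m₁ - 1) ∈ D.verts := by
      by_contra h
      have : ∀ i, m₁ - 1 ≤ i → i ≤ k → ρ i ∉ D.verts := by
        intro i h1 h2
        by_cases hi : i = m₁ - 1
        · rw [hi]; exact h
        · exact hm₁ i (by omega) h2
      exact Nat.find_min hexm (show m₁ - 1 < Nat.find hexm by omega) this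
    -- … to `k + j₀ - 1`
    have hexj : ∃ j, 1 ≤ j ∧ ρ (k + j) ∈ D.verts :=
      ⟨s - k, by omega, by rw [show k + (s - k) = s by omega]; exact hρsG⟩
    obtain ⟨hj₀1, hj₀G⟩ := Nat.find_spec hexj
    set j₀ := Nat.find hexj with hj₀def
    have hj₀le : j₀ ≤ s - k := Nat.find_min' hexj ⟨by omega, by rw [show k + (s - k) = s by omega]; exact hρsG⟩
    have houtj : ∀ j, 1 ≤ j → j < j₀ → ρ (k + j) ∉ D.verts := fun j h1 h2 hG =>
      Nat.find_min hexj (show j < Nat.find hexj from h2) ⟨h1, hG⟩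
    -- entry dart
    have hm₁N : m₁ - 1 + 1 < N := by omega
    have hout₁ : D.rightCell₃ ω (orb (m₁ - 1 + 1)) ∉ D.verts := by
      rw [show m₁ - 1 + 1 = m₁ by omega]; exact hm₁ m₁ le_rfl hm₁k
    obtain ⟨-, -, -, hst⟩ := D.cyc_entry_dart horb hleft hm₁N hin₁ hout₁
    rcases hne0 hst with h1 | h2
    · -- a contact with `A₁` at `m₁ - 1 ∈ [r, s)`: not allowed
      refine hsmin (m₁ - 1) (by omega) (by omega) (Or.inr ⟨hin₁, hm₁N, ?_, ?_⟩)
      · exact hout₁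
      · exact h1
    · -- entered across `A₂`: left across `A₂`, a contact with `A₂` at `k + j₀ > r`
      have hexit := D.cyc_block_exit_two horb hleft (k := m₁ - 1) (n := k + j₀ - m₁)
        (by rw [show m₁ - 1 + (k + j₀ - m₁) + 1 = k + j₀ by omega]; omega) hin₁
        (fun i h1 h2 => by
          by_cases hi : m₁ - 1 + i ≤ k
          · exact hm₁ _ (by omega) hi
          · rw [show m₁ - 1 + i = k + (m₁ - 1 + i - k) by omega]
            exact houtj _ (by omega) (by omega))
        (by omega) (by rw [show m₁ - 1 + (k + j₀ - m₁) + 1 = k + j₀ by omega]; exact hj₀G) h2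
      rw [show m₁ - 1 + (k + j₀ - m₁) + 1 = k + j₀ by omega, show m₁ - 1 + (k + j₀ - m₁) = k + j₀ - 1 by omega] at hexit
      refine hrmax (k + j₀) (by omega) (by omega) (Or.inr ⟨hj₀G, by omega, ?_, hexit⟩)
      show ρ (k + j₀ - 1) ∉ D.verts
      by_cases hj1 : j₀ = 1
      · rw [hj1, Nat.add_sub_cancel]; exact hout
      · rw [show k + j₀ - 1 = k + (j₀ - 1) by omega]; exact houtj _ (by omega) (by omega)
  -- (m2): … and off the path
  have hm2 : ∀ k, r < k → k < s → ρ k ∉ Q := by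
    intro k hk1 hk2 hkQ
    rw [hQeq'] at hkQ
    rcases List.mem_append.1 hkQ with h | h
    · exact hsmin k (by omega) hk2 (Or.inl h)
    · exact hrmax k hk1 (by omega) (Or.inl h)
  rcases Nat.lt_or_ge r s with hrs' | hsr
  · -- the main case
    have hsA : ρ s ∈ L₁ ++ [a] ∨ (ρ s ∉ Q ∧
        ∃ nu', D.pos 1 ≤ nu' ∧ nu' < D.pos 2 ∧ ρ s = (triBdryIter D.verts D.base nu').1) := by
      by_cases h1 : ρ s ∈ L₁ ++ [a]
      · exact Or.inl h1
      · rcases hA1s with h | ⟨hG, hs1, hout, hst⟩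
        · exact absurd h h1
        · have hnQ : ρ s ∉ Q := by
            rw [hQeq']; intro h
            rcases List.mem_append.1 h with h | h
            · exact h1 h
            · exact hrmax s hrs' hsN (Or.inl h)
          obtain ⟨hd, hp1, hpu, ht⟩ := hc1 s hs1 hG hout hst
          exact Or.inr ⟨hnQ, _, hp1, by omega, ht.symm⟩
    have hrT : ρ r ∈ b :: L₂ ∨ (ρ r ∉ Q ∧
        ∃ nv', D.pos 2 ≤ nv' ∧ nv' < L ∧ ρ r = (triBdryIter D.verts D.base nv').1) := by
      by_cases h2 : ρ r ∈ b :: L₂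
      · exact Or.inl h2
      · rcases hA2r with h | ⟨hG, hr1, hout, hst⟩
        · exact absurd h h2
        · have hnQ : ρ r ∉ Q := by
            rw [hQeq']; intro h
            rcases List.mem_append.1 h with h | h
            · exact hsmin r le_rfl hrs' (Or.inl h)
            · exact h2 h
          obtain ⟨hd, hpv, hpL, ht⟩ := hc2 r hr1 (by omega) hG hout hst
          exact Or.inr ⟨hnQ, _, by omega, hpL, ht.symm⟩
    have hne : ρ r ≠ ρ s := by
      intro heq
      rcases hsA with h1 | ⟨h1, -⟩
      · exact hsmin r le_rfl hrs' (Or.inl (heq ▸ h1))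
      · rcases hrT with h2 | ⟨h2, -⟩
        · exact hrmax s hrs' hsN (Or.inl (heq ▸ h2))
        · -- both contacts, off the path: two-sided
          rcases hA2r with h | hA2r'
          · exact h2 (by rw [hQeq']; exact List.mem_append_right _ h)
          · rcases hA1s with h | hA1s'
            · exact h1 (by rw [hQeq']; exact List.mem_append_left _ h)
            · exact htwo r s heq h2 ⟨hA2r'.2.1, by omega, hA2r'.1, hA2r'.2.2.1, hA2r'.2.2.2⟩
                ⟨hA1s'.2.1, hA1s'.1, hA1s'.2.2.1, hA1s'.2.2.2⟩
    exact D.cyc_main_false horb hleft hw0 hQeq hQnd hQch hQG hQω hnu1 hnu2 hnv2 hnvL hQhead hQlast hnotw hrs' hsN'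
      (fun k h1 h2 => by
        rcases Nat.lt_or_ge r k with hk | hk
        · rcases Nat.lt_or_ge k s with hk' | hk'
          · exact hm1 k hk hk'
          · rw [show k = s by omega]; exact hρsG
        · rw [show k = r by omega]; exact hρrG)
      hm2 hne hsA hrT
  · -- the degenerate cases: `r = s`
    have hrs0 : r = s := le_antisymm hrs hsr
    by_cases h2 : ρ r ∈ b :: L₂ <;> by_cases h1 : ρ s ∈ L₁ ++ [a]
    · exact hdisj _ h1 (hrs0 ▸ h2)
    · rcases hA1s with h | ⟨hG, hs1, hout, hst⟩
      · exact h1 h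
      · obtain ⟨hd, hp1, hpu, ht⟩ := hc1 s hs1 hG hout hst
        exact D.false_of_contact_one hQeq hQnd hQch hQG hQω hnu1 hnu2 hnv2 hnvL hQhead hQlast hC hπw hnotw hw
          (hrs0 ▸ h2) hp1 hpu ht
    · rcases hA2r with h | ⟨hG, hr1, hout, hst⟩
      · exact h2 h
      · obtain ⟨hd, hpv, hpL, ht⟩ := hc2 r hr1 (by omega) hG hout hst
        exact D.false_of_contact_two hQeq hQnd hQch hQG hQω hnu1 hnu2 hnv2 hnvL hQhead hQlast hC hπw hnotw hw
          (hrs0 ▸ h1) hpv hpL ht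
    · rcases hA2r with h | hA2r'
      · exact h2 h
      · rcases hA1s with h | hA1s'
        · exact h1 h
        · have hnQ : ρ r ∉ Q := by
            rw [hQeq']; intro h
            rcases List.mem_append.1 h with h | h
            · exact h1 (hrs0 ▸ h)
            · exact h2 h
          exact htwo r s (by rw [hrs0]) hnQ ⟨hA2r'.2.1, by omega, hA2r'.1, hA2r'.2.2.1, hA2r'.2.2.2⟩
            ⟨hA1s'.2.1, hA1s'.1, hA1s'.2.2.1, hA1s'.2.2.2⟩

end CycleFalse

end TriMarkedDomain

end Literature.Probability.Percolation
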